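import Literature.Computability.AlgebraicComplexity.KoiranPortierTavenas2015.WronskianZeroBoundsRefined
import Literature.Computability.AlgebraicComplexity.RealTauKnownCases
import HarnessLib

/-!
# Koiran–Portier–Tavenas 2015, §3 "Applications": Theorems 12 and 13 — real zeros of
# sums of products of powers of sparse (resp. low-degree) polynomials (PROVED)

P. Koiran, N. Portier, S. Tavenas, *A Wronskian approach to the real τ-conjecture*, J. Symbolic
Comput. **68**:2 (2015) 195–214 = arXiv:1205.1015 [KoiranPortierTavenas2015]; held text
`paper:arxiv-1205.1015` (corpus-tex, 18 chunks `p0001`–`p0018`; the numbering "Lemma 10, 11,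
Thm. 12, 13" is the one of that text, of the sibling files and of the routes citing the paper).
THEOREMS ONLY (0 definitions, 0 named facts). This is the third file of the directory after
`WronskianZeroBounds.lean` (§2: Lemmas 3–5, Thms. 7–8) and `WronskianZeroBoundsRefined.lean`
(§5: Thm. 9): the §3 APPLICATION that the route texts actually quote. Printed statements:

* **Theorem 12** (p0006:L60–70): "Let `f = Σ_{i=1}^{k} a_i Π_{j=1}^{m} f_j^{α_{i,j}}` be a non
  identically zero function such that `f_j` is a polynomial with at most `t` monomials and such
  that `a_i ∈ ℝ` and `α_{i,j} ∈ ℕ`. Then `Z_ℝ(f) ≤ 4ktm + 4(e(1+t))^{mk²/2} = O(t^{mk²/2})`.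
  Moreover, if `I` is a real interval such that for all `j`, `f_j(I) ⊆ ]0,+∞[` (which ensures `f`
  is defined on `I`), then the result is still true for real (possibly negative) powers
  `α_{i,j}`, i.e., `Z_I(f) ≤ 4ktm + 4(e(1+t))^{mk²/2}`." — `KPT2015_thm_12` (first sentence, as
  printed: `(P.roots.toFinset.card : ℝ) ≤ 4ktm + 4 (exp 1 · (1+t))^{(mk²)/2}`),
  `KPT2015_thm_12_realZeros` (the same with the sibling files' `realZeros`), and the sharper
  INTERMEDIATE bound of the printed proof (p0007:L31–54: "`Z(f) ≤ k − 1 + 2k(2t−1)m +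
  2 Σ_{s=1}^{k} (2 C(mC(s,2)+mt−1, mt−1) − 1)`") as `KPT2015_thm_12_combinatorial`.
* **Theorem 13** (p0007:L67–72): "Let `f = Σ_{i=1}^{k} a_i Π_{j=1}^{m} f_j^{α_{i,j}}` where `f` is
  not null, the `f_j` are of degrees bounded by `d` and such that `a_i` are reals and `α_i` are
  integers. Then `Z_ℝ(f) ≤ (1/3)k³md + 2kmd + k ∼ k³md/3`. Moreover, [the same for real powers
  on an interval where every `f_j > 0`]." — `KPT2015_thm_13`, `KPT2015_thm_13_realZeros`, and the
  intermediate bound `k − 1 + 2 Σ_{s=1}^{k} (md + md·C(s,2))` as `KPT2015_thm_13_combinatorial`.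
* **Lemma 11** (p0006:L51–58, the monomial count `|E_{d,e}| ≤ C(d+T−1, T−1)`) —
  `card_sumClass_le` / `card_support_le_of_sumClass`; **Lemma 10** (p0006:L28, the `p`-th
  derivative of a power `f^α`) is NOT typed: see "Proof" below.
* The elementary closing estimates (p0007:L56–62 "we use the well known bound
  `C(n,k) ≤ (en/k)^k` … `≤ 4ktm + 4(e(1+t))^{mk²/2}`"; p0007:L75–78) —
  `KPT2015_thm_12_estimate`, `KPT2015_thm_13_estimate`, `choose_le_exp_mul_pow`.

**Typed-vs-printed (honest scope).** (1) `f` is typed as the real POLYNOMIAL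
`P = Σ_{i:ι} C(a_i) · Π_{j:κ} f_j^{α i j}` over finite index types `ι` (`k = |ι|` terms) and `κ`
(`m = |κ|` polynomials `f_j : ℝ[X]`), exponents `α : ι → κ → ℕ`; "non identically zero" is
`P ≠ 0`; "at most `t` monomials" is `(f_j).support.card ≤ t` (the zero polynomial is allowed, as
in print, and handled by `sum_prod_pow_eq_subtype`); "degrees bounded by `d`" is
`natDegree f_j ≤ d`; `Z_ℝ(f)`, "the number of distinct real roots" (Def. 6), is
`P.roots.toFinset.card`, which is the sibling files' `realZeros (fun x => P.eval x)`
(`realZeros_eval_poly`). (2) The printed bounds are typed VERBATIM as real numbers: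
`4·k·t·m + 4·(Real.exp 1 · (1 + t)) ^ ((m·k²)/2 : ℝ)` (real exponent) and
`k³md/3 + 2kmd + k`. (3) NOT typed in this file: the two "Moreover" clauses — REAL (possibly
negative) exponents `α_{i,j}` on an interval `I` with `f_j(I) ⊆ ]0,+∞[`, counting `Z_I` — which
need the analytic (not polynomial) version of the factorisation below.
`-- TODO(general form): real powers α_{i,j} on an open interval where every f_j > 0 (Thms. 12/13,
"Moreover").` They are typed, with Cors. 14–15 (Avendaño's family, Li–Rojas–Wang), in the
sibling `SumOfProductsOfRealPowers.lean`. (4) §4.1's Cors. 16–17 (the zero bounds as HITTING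
SETS for blackbox PIT: "the first `1 + 4ktm + 4(e(1+t))^{mk²/2}` integers") are typed at the end
of this file as their printed mathematical content (`KPT2015_cor_16`, `KPT2015_cor_17`); the
algorithmic wording ("there is a blackbox PIT algorithm which makes only … queries") is not.

**Proof** (the printed one, §3.2, p0006:L72 – p0007:L63). Multiply `f` by `(Π_j f_j)^{k−1}`
(the printed `f̃ = f · Π_j f_j^{N+k}`, `N = 0` for natural exponents; zeros of `f` are zeros of
`f̃`); "we can assume without loss of generality that the family `(g_i)` is linearly independent
… all `a_i` non-zero" = `exists_linearIndependent_subfamily` (`s₀ ≤ k` terms); Theorem 9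
(`KPT2015_thm_9_real`, the tree's §5 file — the print's `thm_main3`) bounds `Z(f̃)` by
`s₀ − 1 + Z(W_{s₀}) + Z(W_{s₀−1}) + 2Σ_{j ≤ s₀−2} Z(W_j) ≤ k − 1 + 2 Σ_{s=1}^{k} Z(W_s)`, the
Wronskians `W_s = W(g_1,…,g_s)` being non-zero polynomials by Lemma 5 (Bôcher,
`KPT2015_lemma_5_real`) and linear independence; the FACTORISATION (p0007:L11–24)
`W(g_1,…,g_s) = (Π_{i≤s} Π_j f_j^{α_ij+…}) · (Π_j f_j)^{N'} · det(T_{u,v})` with every monomial of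
`det(T_{u,v})` in `E_{m·C(s,2), C(s,2)} = x^{−C(s,2)} M^{m·C(s,2)}` (`M` = the `≤ mt` monomials of
the `f_j`) — `wronskian_det_factorisation`; hence (p0007:L18–30) `Z(W_s) ≤ Σ_j Z(f_j) +
Z(det T) ≤ m(2t−1) + 2·C(mC(s,2)+mt−1, mt−1) − 1` by the weak rule of signs (Lemma 2 of the
paper = the tree's `card_roots_toFinset_le_of_card_support`) and the count of Lemma 11 —
`card_roots_wronskian_det_le`; for Theorem 13 the degree of `det T` is `≤ md·C(s,2)` —
`card_roots_wronskian_det_le_of_degree`. ONE DEVIATION, disclosed: the print derives the support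
class of the entries `g_u^{(v−1)}` from Lemma 10 (Faà di Bruno for `(f^α)^{(p)}`); here the same
class `E_{(v−1)m, v−1}` is obtained by iterating one Leibniz step
(`derivative_prod_pow_succ_mul`, `iterate_derivative_prod_pow_add_mul`): `((Π_j f_j^{γ_j+1})·Q)' =
(Π_j f_j^{γ_j})·Q⁺` with `Q⁺` one class higher — the same set `E_{d,e}`, the same count, a
shorter Lean road. The support classes are spelled out inline (no definition): "`Q` has class
`(d,e)` over `A`" means `∀ n ∈ Q.support, n + e ∈ image (c ↦ Σ_{a∈A} c a · a) (A.finsuppAntidiag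
d)`, i.e. the monomials of `Q` lie in `x^{−e}·A^{d}` (`d`-fold sums, multiplicities
`c ∈ A.finsuppAntidiag d`), counted by Mathlib's `Finset.card_finsuppAntidiag_nat_eq_choose`
(stars and bars, `C(|A|+d−1, d)`).

Negative knowledge in this directory (not restated): `AnswerNo.lean` REFUTES the §6 question
(`kpt_open_question_answer_is_no`: Theorem 8's bound without the factor `k`) and
`tavenasWronskianBound_false`; Theorems 12 and 13 are unconditional printed theorems and do not
touch those statements.

Consumers / context: the route texts `Summits/ValiantsHypothesis/ValiantsHypothesis/Theses/
LacunarySymmetroid.lean` (l.183: "fixed `m`: `Z ≤ poly_m(K)` by KoiranPortierTavenas2015 Thm 12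
(`Σ_{i≤k}Π_j f_j^{α_ij}` has `≤ 4ktm + 4(e(1+t))^{mk²/2}` real zeros; `m = 2`: three squares)"),
`RealTau.lean` (l.110/220/311: "Wronskians give `t^{O(mk²)}` (KPT15 Thm 12)"),
`SymmetroidDescartes.lean` (l.120/279: "KoiranPortierTavenas2015 Thm 12 with `k = 3`"),
`KPlusLogSqLaw.lean` (l.152: "fixed-`K` rungs are Descartes-zone (Koiran–Portier–Tavenas 2015
Thm 12)") quote this bound as THE known tool; it is now a theorem of the tree. Cell `val-lit`
(t14 g10, own pick in métier, lead-lmr RULING #10; LADDER-VALIANT V1 literature, dictionary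
shelf). Honest framing: a 2015 real-root bound (improving Grenet–Koiran–Portier–Strozecki 2011's
`t^{O(m 2^k)}`) becoming a tree theorem; census-neutral (no named fact is added or discharged);
not a rung; `MatrixDescartes` untouched; nothing here bears on VP versus VNP.

## References

* [KoiranPortierTavenas2015] P. Koiran, N. Portier, S. Tavenas, *A Wronskian approach to the real
  τ-conjecture*, J. Symbolic Comput. 68 (2015) 195–214, doi:10.1016/j.jsc.2014.09.036,
  arXiv:1205.1015 — §3: Lemmas 10–11, Theorems 12–13 (held text p0006–p0007).
* B. Grenet, P. Koiran, N. Portier, Y. Strozecki, *The limited power of powering: polynomial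
  identity testing and a depth-four lower bound for the permanent*, FSTTCS 2011 (the print's
  [GKPS11], the `t^{O(m2^k)}` bound improved by Theorem 12; cited in print only).
-/

noncomputable section

open Polynomial Finset

namespace Literature.Computability.AlgebraicComplexity.KoiranPortierTavenas2015

/-! ### Polynomial families: the Wronskian of the evaluation maps is the evaluation of the
polynomial Wronskian -/

/-- The `r`-th derivative of a real polynomial function is the polynomial function of the `r`-th
formal derivative. [folklore] -/
private theorem iteratedDeriv_eval_poly (q : ℝ[X]) (r : ℕ) :
    iteratedDeriv r (fun x => q.eval x) = fun x => (derivative^[r] q).eval x := by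
  induction r with
  | zero => simp
  | succ r ih =>
    rw [iteratedDeriv_succ, ih, Function.iterate_succ_apply']
    funext x
    exact Polynomial.deriv _

/-- For a family of real polynomials `p 0, p 1, …`, the Wronskian `W(p 0, …, p (s−1))` of the
polynomial FUNCTIONS (the sibling file's `wronskian`) is the evaluation of the polynomial
determinant `det ((p u)^{(v)})_{v,u<s}`.
[cite: KoiranPortierTavenas2015, §2 (p0005:L3, definition of `W`)] -/
theorem wronskian_eval_poly (p : ℕ → ℝ[X]) (s : ℕ) (x : ℝ) :
    wronskian (fun n y => (p n).eval y) s x =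
      (Matrix.det (Matrix.of fun v u : Fin s => derivative^[(v : ℕ)] (p u))).eval x := by
  unfold wronskian
  rw [← Polynomial.coe_evalRingHom, RingHom.map_det]
  congr 1
  ext v u
  simp [RingHom.mapMatrix_apply, iteratedDeriv_eval_poly]

/-- The real zero set of a non-zero real polynomial is the finite set of its roots. [folklore] -/
private theorem zeroSet_eval_eq_roots_toFinset {q : ℝ[X]} (hq : q ≠ 0) :
    {x : ℝ | q.eval x = 0} = ↑q.roots.toFinset := by
  ext x
  simp [Polynomial.mem_roots hq, IsRoot.def]

/-- `Z_ℝ` (the sibling file's `realZeros`) of a non-zero real polynomial function is its number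
of distinct real roots. [cite: KoiranPortierTavenas2015, Def. 6 (p0005:L29, `Z_I`)] -/
theorem realZeros_eval_poly {q : ℝ[X]} (hq : q ≠ 0) :
    realZeros (fun x => q.eval x) = q.roots.toFinset.card := by
  unfold realZeros
  rw [zeroSet_eval_eq_roots_toFinset hq, Set.encard_coe_eq_coe_finsetCard]

/-! ### The support classes `E_{d,e} = x^{−e}·M^d` of KPT Lemma 11

For a finite set `A ⊆ ℕ` of exponents (the monomials `M` of the print), the `d`-fold sums of
elements of `A` are the image of `A.finsuppAntidiag d` (multiplicities `c : ℕ →₀ ℕ` supported in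
`A` with `Σ_{a∈A} c a = d`) under `c ↦ Σ_{a∈A} c a · a`; a polynomial `Q` is "of class `(d, e)`"
when every exponent `n` of its support has `n + e` such a `d`-fold sum — i.e. its monomials lie
in the printed set `E_{d,e} = x^{−e} M^d` (p0006:L51–58). No definition is introduced: the class
is spelled out in each statement. -/

section SupportClass

variable {R : Type*}

/-- `0` is a `0`-fold sum from `A`.
[cite: KoiranPortierTavenas2015, Lemma 11 (p0006:L51–58, the sets `E_{d,e} = x^{−e}M^d`)] -/
theorem zero_mem_sumClass (A : Finset ℕ) :
    (0 : ℕ) ∈ (A.finsuppAntidiag 0).image fun c => ∑ a ∈ A, c a * a := by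
  classical
  refine mem_image.mpr ⟨0, ?_, by simp⟩
  simp

/-- An element of `A` is a `1`-fold sum from `A`.
[cite: KoiranPortierTavenas2015, Lemma 11 (p0006:L51–58, the sets `E_{d,e} = x^{−e}M^d`)] -/
theorem mem_sumClass_one {A : Finset ℕ} {a : ℕ} (ha : a ∈ A) :
    a ∈ (A.finsuppAntidiag 1).image fun c => ∑ a ∈ A, c a * a := by
  classical
  refine mem_image.mpr ⟨Finsupp.single a 1, ?_, ?_⟩
  · rw [mem_finsuppAntidiag]
    refine ⟨?_, ?_⟩
    · simp [Finsupp.single_apply, ha]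
    · exact Finsupp.support_single_subset.trans (Finset.singleton_subset_iff.mpr ha)
  · simp [Finsupp.single_apply, ha]

/-- `d₁`-fold plus `d₂`-fold sums from `A` are `(d₁+d₂)`-fold sums.
[cite: KoiranPortierTavenas2015, Lemma 11 (p0006:L51–58, the sets `E_{d,e} = x^{−e}M^d`)] -/
theorem add_mem_sumClass {A : Finset ℕ} {d₁ d₂ x y : ℕ}
    (hx : x ∈ (A.finsuppAntidiag d₁).image fun c => ∑ a ∈ A, c a * a)
    (hy : y ∈ (A.finsuppAntidiag d₂).image fun c => ∑ a ∈ A, c a * a) :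
    x + y ∈ (A.finsuppAntidiag (d₁ + d₂)).image fun c => ∑ a ∈ A, c a * a := by
  classical
  obtain ⟨c₁, hc₁, rfl⟩ := mem_image.mp hx
  obtain ⟨c₂, hc₂, rfl⟩ := mem_image.mp hy
  rw [mem_finsuppAntidiag] at hc₁ hc₂
  refine mem_image.mpr ⟨c₁ + c₂, ?_, ?_⟩
  · rw [mem_finsuppAntidiag]
    refine ⟨?_, ?_⟩
    · simp [Finsupp.add_apply, sum_add_distrib, hc₁.1, hc₂.1]
    · exact Finsupp.support_add.trans (union_subset hc₁.2 hc₂.2)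
  · simp [Finsupp.add_apply, add_mul, sum_add_distrib]

/-- A `d`-fold sum from `A ⊆ [0, D]` is at most `d·D`.
[cite: KoiranPortierTavenas2015, Lemma 11 (p0006:L51–58, the sets `E_{d,e} = x^{−e}M^d`)] -/
theorem le_of_mem_sumClass {A : Finset ℕ} {D d x : ℕ} (hA : ∀ a ∈ A, a ≤ D)
    (hx : x ∈ (A.finsuppAntidiag d).image fun c => ∑ a ∈ A, c a * a) : x ≤ d * D := by
  classical
  obtain ⟨c, hc, rfl⟩ := mem_image.mp hx
  rw [mem_finsuppAntidiag] at hc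
  calc ∑ a ∈ A, c a * a ≤ ∑ a ∈ A, c a * D :=
        sum_le_sum fun a ha => Nat.mul_le_mul_left _ (hA a ha)
    _ = d * D := by rw [← sum_mul, hc.1]

/-- The number of `d`-fold sums from `A` is at most the number of multisets of size `d` from
`A`, `C(|A|+d−1, d)` (KPT Lemma 11: "the cardinal of this set is bounded by the cardinal of the set
of multisets of size `d` of elements in `M`, that is `C(T+d−1, T−1)`").
[cite: KoiranPortierTavenas2015, Lemma 11 (p0006:L51–58)] -/
theorem card_sumClass_le (A : Finset ℕ) (d : ℕ) :
    ((A.finsuppAntidiag d).image fun c => ∑ a ∈ A, c a * a).card ≤ (A.card + d - 1).choose d := by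
  classical
  calc _ ≤ (A.finsuppAntidiag d).card := card_image_le
    _ = (A.card + d - 1).choose d := card_finsuppAntidiag_nat_eq_choose d

/-- Class `(d,e)` is inherited by sums.
[cite: KoiranPortierTavenas2015, Lemma 11 (p0006:L51–58, the sets `E_{d,e} = x^{−e}M^d`)] -/
theorem sumClass_add [Semiring R] {A : Finset ℕ} {d e : ℕ} {P Q : R[X]}
    (hP : ∀ n ∈ P.support, n + e ∈ (A.finsuppAntidiag d).image fun c => ∑ a ∈ A, c a * a)
    (hQ : ∀ n ∈ Q.support, n + e ∈ (A.finsuppAntidiag d).image fun c => ∑ a ∈ A, c a * a) :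
    ∀ n ∈ (P + Q).support, n + e ∈ (A.finsuppAntidiag d).image fun c => ∑ a ∈ A, c a * a := by
  intro n hn
  rw [mem_support_iff, coeff_add] at hn
  by_cases hPn : P.coeff n = 0
  · rw [hPn, zero_add] at hn
    exact hQ n (mem_support_iff.mpr hn)
  · exact hP n (mem_support_iff.mpr hPn)

/-- Class `(d,e)` is inherited by finite sums.
[cite: KoiranPortierTavenas2015, Lemma 11 (p0006:L51–58, the sets `E_{d,e} = x^{−e}M^d`)] -/
theorem sumClass_sum [Semiring R] {β : Type*} {A : Finset ℕ} {d e : ℕ} (s : Finset β)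
    (g : β → R[X])
    (hg : ∀ b ∈ s, ∀ n ∈ (g b).support,
      n + e ∈ (A.finsuppAntidiag d).image fun c => ∑ a ∈ A, c a * a) :
    ∀ n ∈ (∑ b ∈ s, g b).support,
      n + e ∈ (A.finsuppAntidiag d).image fun c => ∑ a ∈ A, c a * a := by
  classical
  induction s using Finset.induction_on with
  | empty => simp
  | insert b s hb ih =>
    rw [sum_insert hb]
    exact sumClass_add (hg b (mem_insert_self b s))
      (ih fun b' hb' => hg b' (mem_insert_of_mem hb'))

/-- Class `(d,e)` is inherited by scalar multiples.
[cite: KoiranPortierTavenas2015, Lemma 11 (p0006:L51–58, the sets `E_{d,e} = x^{−e}M^d`)] -/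
theorem sumClass_smul [Semiring R] {S : Type*} [SMulZeroClass S R] {A : Finset ℕ} {d e : ℕ}
    {P : R[X]} (z : S)
    (hP : ∀ n ∈ P.support, n + e ∈ (A.finsuppAntidiag d).image fun c => ∑ a ∈ A, c a * a) :
    ∀ n ∈ (z • P).support, n + e ∈ (A.finsuppAntidiag d).image fun c => ∑ a ∈ A, c a * a := by
  intro n hn
  rw [mem_support_iff, coeff_smul] at hn
  refine hP n (mem_support_iff.mpr ?_)
  intro h
  exact hn (by rw [h, smul_zero])

/-- Class `(d,e)` is inherited by left multiplication with a constant.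
[cite: KoiranPortierTavenas2015, Lemma 11 (p0006:L51–58, the sets `E_{d,e} = x^{−e}M^d`)] -/
theorem sumClass_C_mul [Semiring R] {A : Finset ℕ} {d e : ℕ} {P : R[X]} (b : R)
    (hP : ∀ n ∈ P.support, n + e ∈ (A.finsuppAntidiag d).image fun c => ∑ a ∈ A, c a * a) :
    ∀ n ∈ (C b * P).support, n + e ∈ (A.finsuppAntidiag d).image fun c => ∑ a ∈ A, c a * a := by
  intro n hn
  rw [mem_support_iff, coeff_C_mul] at hn
  exact hP n (mem_support_iff.mpr (right_ne_zero_of_mul hn))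

/-- A constant is of class `(0,0)`.
[cite: KoiranPortierTavenas2015, Lemma 11 (p0006:L51–58, the sets `E_{d,e} = x^{−e}M^d`)] -/
theorem sumClass_C [Semiring R] (A : Finset ℕ) (b : R) :
    ∀ n ∈ (C b).support, n + 0 ∈ (A.finsuppAntidiag 0).image fun c => ∑ a ∈ A, c a * a := by
  intro n hn
  have hn0 : n = 0 := by
    have := support_C_subset b hn
    simpa using this
  subst hn0
  exact zero_mem_sumClass A

/-- A polynomial with exponents in `A` is of class `(1,0)`.
[cite: KoiranPortierTavenas2015, Lemma 11 (p0006:L51–58, the sets `E_{d,e} = x^{−e}M^d`)] -/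
theorem sumClass_of_support_subset [Semiring R] {A : Finset ℕ} {P : R[X]}
    (hP : ∀ n ∈ P.support, n ∈ A) :
    ∀ n ∈ P.support, n + 0 ∈ (A.finsuppAntidiag 1).image fun c => ∑ a ∈ A, c a * a :=
  fun n hn => by simpa using mem_sumClass_one (hP n hn)

/-- A non-zero coefficient of a product comes from non-zero coefficients of the factors.
[folklore] -/
private theorem exists_add_eq_of_mem_support_mul [Semiring R] {P Q : R[X]} {n : ℕ}
    (hn : n ∈ (P * Q).support) : ∃ i ∈ P.support, ∃ j ∈ Q.support, i + j = n := by
  rw [mem_support_iff, coeff_mul] at hn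
  obtain ⟨x, hx, hne⟩ := Finset.exists_ne_zero_of_sum_ne_zero hn
  exact ⟨x.1, mem_support_iff.mpr (left_ne_zero_of_mul hne), x.2,
    mem_support_iff.mpr (right_ne_zero_of_mul hne), by simpa using hx⟩

/-- Classes multiply: `(d₁,e₁)·(d₂,e₂) ⊆ (d₁+d₂, e₁+e₂)` ("`E_{d,e}·E_{d',e'} ⊆ E_{d+d',e+e'}`").
[cite: KoiranPortierTavenas2015, Lemma 11 (p0006:L51–58, the sets `E_{d,e} = x^{−e}M^d`)] -/
theorem sumClass_mul [Semiring R] {A : Finset ℕ} {d₁ e₁ d₂ e₂ d e : ℕ} {P Q : R[X]}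
    (hP : ∀ n ∈ P.support, n + e₁ ∈ (A.finsuppAntidiag d₁).image fun c => ∑ a ∈ A, c a * a)
    (hQ : ∀ n ∈ Q.support, n + e₂ ∈ (A.finsuppAntidiag d₂).image fun c => ∑ a ∈ A, c a * a)
    (hd : d₁ + d₂ = d) (he : e₁ + e₂ = e) :
    ∀ n ∈ (P * Q).support, n + e ∈ (A.finsuppAntidiag d).image fun c => ∑ a ∈ A, c a * a := by
  intro n hn
  obtain ⟨i, hi, j, hj, rfl⟩ := exists_add_eq_of_mem_support_mul hn
  subst hd he
  have : i + j + (e₁ + e₂) = (i + e₁) + (j + e₂) := by ring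
  rw [this]
  exact add_mem_sumClass (hP i hi) (hQ j hj)

/-- `1` is of class `(0,0)`.
[cite: KoiranPortierTavenas2015, Lemma 11 (p0006:L51–58, the sets `E_{d,e} = x^{−e}M^d`)] -/
theorem sumClass_one [Semiring R] (A : Finset ℕ) :
    ∀ n ∈ (1 : R[X]).support, n + 0 ∈ (A.finsuppAntidiag 0).image fun c => ∑ a ∈ A, c a * a := by
  rw [← C_1]
  exact sumClass_C A 1

/-- Classes of finite products add up.
[cite: KoiranPortierTavenas2015, Lemma 11 (p0006:L51–58, the sets `E_{d,e} = x^{−e}M^d`)] -/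
theorem sumClass_prod [CommSemiring R] {β : Type*} {A : Finset ℕ} (s : Finset β) (g : β → R[X])
    (dd ee : β → ℕ)
    (hg : ∀ b ∈ s, ∀ n ∈ (g b).support,
      n + ee b ∈ (A.finsuppAntidiag (dd b)).image fun c => ∑ a ∈ A, c a * a)
    {d e : ℕ} (hd : ∑ b ∈ s, dd b = d) (he : ∑ b ∈ s, ee b = e) :
    ∀ n ∈ (∏ b ∈ s, g b).support,
      n + e ∈ (A.finsuppAntidiag d).image fun c => ∑ a ∈ A, c a * a := by
  classical
  induction s using Finset.induction_on generalizing d e with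
  | empty =>
    simp only [sum_empty] at hd he
    subst hd he
    simpa using sumClass_one (R := R) A
  | insert b s hb ih =>
    rw [sum_insert hb] at hd he
    rw [prod_insert hb]
    exact sumClass_mul (hg b (mem_insert_self b s))
      (ih (fun b' hb' => hg b' (mem_insert_of_mem hb')) rfl rfl) hd he

/-- The derivative shifts the class: `(d,e) ↦ (d,e+1)` ("the set of monomials of `x^{-e}M^d`").
[cite: KoiranPortierTavenas2015, Lemma 11 (p0006:L51–58, the sets `E_{d,e} = x^{−e}M^d`)] -/
theorem sumClass_derivative [Semiring R] {A : Finset ℕ} {d e e' : ℕ} {P : R[X]}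
    (hP : ∀ n ∈ P.support, n + e ∈ (A.finsuppAntidiag d).image fun c => ∑ a ∈ A, c a * a)
    (he : e + 1 = e') :
    ∀ n ∈ (derivative P).support,
      n + e' ∈ (A.finsuppAntidiag d).image fun c => ∑ a ∈ A, c a * a := by
  intro n hn
  subst he
  rw [mem_support_iff, coeff_derivative] at hn
  have h1 : P.coeff (n + 1) ≠ 0 := left_ne_zero_of_mul hn
  have : n + (e + 1) = (n + 1) + e := by ring
  rw [this]
  exact hP (n + 1) (mem_support_iff.mpr h1)

/-- The negative has the same class.
[cite: KoiranPortierTavenas2015, Lemma 11 (p0006:L51–58, the sets `E_{d,e} = x^{−e}M^d`)] -/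
theorem sumClass_neg [Ring R] {A : Finset ℕ} {d e : ℕ} {P : R[X]}
    (hP : ∀ n ∈ P.support, n + e ∈ (A.finsuppAntidiag d).image fun c => ∑ a ∈ A, c a * a) :
    ∀ n ∈ (-P).support, n + e ∈ (A.finsuppAntidiag d).image fun c => ∑ a ∈ A, c a * a := by
  intro n hn
  rw [support_neg] at hn
  exact hP n hn

/-- **Counting (KPT Lemma 11).** A polynomial of class `(d,e)` over `A` with `|A| ≤ T` has at most
`C(T+d−1, d)` monomials ("the number of monomials in `x` of `P(f_1, f_1', …)` is bounded by
`C(d+T−1, T−1)`", which is the same binomial coefficient when `T ≥ 1`).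
[cite: KoiranPortierTavenas2015, Lemma 11 (p0006:L51–58)] -/
theorem card_support_le_of_sumClass [Semiring R] {A : Finset ℕ} {d e T : ℕ} {P : R[X]}
    (hP : ∀ n ∈ P.support, n + e ∈ (A.finsuppAntidiag d).image fun c => ∑ a ∈ A, c a * a)
    (hT : A.card ≤ T) : P.support.card ≤ (T + d - 1).choose d := by
  classical
  calc P.support.card ≤ ((A.finsuppAntidiag d).image fun c => ∑ a ∈ A, c a * a).card :=
        Finset.card_le_card_of_injOn (· + e) (fun n hn => by simpa using hP n (by simpa using hn))
          (fun _ _ _ _ h => by simpa using h)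
    _ ≤ (A.card + d - 1).choose d := card_sumClass_le A d
    _ ≤ (T + d - 1).choose d := Nat.choose_le_choose d (by omega)

/-- **Degree version.** A polynomial of class `(d,e)` over `A ⊆ [0, D]` has degree at most
`d·D − e` (used for Theorem 13: "`det(T_{u,v})` … is of degree `md·C(s,2)` in the variable `x`").
[cite: KoiranPortierTavenas2015, proof of Thm. 13 (p0007:L71–74)] -/
theorem natDegree_le_of_sumClass [Semiring R] {A : Finset ℕ} {d e D : ℕ} {P : R[X]}
    (hP : ∀ n ∈ P.support, n + e ∈ (A.finsuppAntidiag d).image fun c => ∑ a ∈ A, c a * a)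
    (hA : ∀ a ∈ A, a ≤ D) : P.natDegree ≤ d * D - e := by
  rw [natDegree_le_iff_coeff_eq_zero]
  intro n hn
  by_contra h
  have := le_of_mem_sumClass hA (hP n (mem_support_iff.mpr h))
  have hn' : (d * D - e : ℕ) < n := by exact_mod_cast hn
  omega

end SupportClass

/-! ### The Wronskian factorisation (KPT p0006:L73 – p0007:L30)

For `g_u = b_u · Π_j f_j^{e_{uj}}` with all `e_{uj} ≥ s − 1`, every derivative `g_u^{(v)}`,
`v < s`, is `(Π_j f_j^{e_{uj} − v}) · P_{u,v}` with `P_{u,v}` of class `(v·m, v)`; pulling the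
common factors out of the rows and columns of the Wronskian matrix leaves `det(P_{u,v})`, of class
`(m·C(s,2), C(s,2))` — the printed "`det(T_{u,v})` is a linear combination of monomials of degree
exactly `m·C(s,2)` and of order of differentiation `C(s,2)` in the `s²` variables `f_p^{(q−1)}`".
The print reaches the same factorisation through Lemma 10 (the `p`-th derivative of a power,
Faà di Bruno); here the class bookkeeping is done by one Leibniz step iterated `v` times, which is
shorter in Lean and lands in the same set `E_{m·C(s,2), C(s,2)}`. -/

section Factorisation

variable {κ : Type*} [Fintype κ] [DecidableEq κ]

/-- One Leibniz step: `((Π_j f_j^{γ_j+1}) · Q)' = (Π_j f_j^{γ_j}) · Q⁺` with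
`Q⁺ = (Σ_j (γ_j+1) f_j' Π_{j'≠j} f_{j'}) · Q + (Π_j f_j) · Q'`, and the class moves from `(d,e)` to
`(d+m, e+1)` (`m = |κ|`).
[cite: KoiranPortierTavenas2015, proof of Thm. 12 (p0006:L78–81, p0007:L1–9)] -/
theorem derivative_prod_pow_succ_mul (A : Finset ℕ) (f : κ → ℝ[X])
    (hfA : ∀ j, ∀ n ∈ (f j).support, n ∈ A) (γ : κ → ℕ) (Q : ℝ[X]) {d e : ℕ}
    (hQ : ∀ n ∈ Q.support, n + e ∈ (A.finsuppAntidiag d).image fun c => ∑ a ∈ A, c a * a) :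
    ∃ Q' : ℝ[X], (∀ n ∈ Q'.support, n + (e + 1) ∈
        (A.finsuppAntidiag (d + Fintype.card κ)).image fun c => ∑ a ∈ A, c a * a) ∧
      derivative ((∏ j, f j ^ (γ j + 1)) * Q) = (∏ j, f j ^ γ j) * Q' := by
  classical
  set D : ℝ[X] := ∑ j, C ((γ j : ℝ) + 1) * (∏ j' ∈ univ.erase j, f j') * derivative (f j)
    with hD
  refine ⟨D * Q + (∏ j, f j) * derivative Q, ?_, ?_⟩
  · -- the class of `Q⁺`
    have hDcl : ∀ n ∈ D.support, n + 1 ∈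
        (A.finsuppAntidiag (Fintype.card κ)).image fun c => ∑ a ∈ A, c a * a := by
      rw [hD]
      refine sumClass_sum _ _ fun j _ => ?_
      have h1 : ∀ n ∈ (C ((γ j : ℝ) + 1) * ∏ j' ∈ univ.erase j, f j').support,
          n + 0 ∈ (A.finsuppAntidiag ((univ.erase j).card)).image fun c => ∑ a ∈ A, c a * a :=
        sumClass_C_mul _ (sumClass_prod (univ.erase j) f (fun _ => 1) (fun _ => 0)
          (fun j' _ => sumClass_of_support_subset (hfA j')) (by simp) (by simp))
      exact sumClass_mul h1 (sumClass_derivative (sumClass_of_support_subset (hfA j)) rfl)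
        (by rw [Finset.card_erase_of_mem (mem_univ j), Finset.card_univ]
            have := Fintype.card_pos_iff.mpr ⟨j⟩
            omega)
        (by simp)
    have hPi : ∀ n ∈ (∏ j, f j).support,
        n + 0 ∈ (A.finsuppAntidiag (Fintype.card κ)).image fun c => ∑ a ∈ A, c a * a :=
      sumClass_prod univ f (fun _ => 1) (fun _ => 0)
        (fun j' _ => sumClass_of_support_subset (hfA j')) (by simp) (by simp)
    exact sumClass_add (sumClass_mul hDcl hQ (by ring) (by ring))
      (sumClass_mul hPi (sumClass_derivative hQ rfl) (by ring) (by ring))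
  · -- the identity
    have hder : derivative (∏ j, f j ^ (γ j + 1)) = (∏ j, f j ^ γ j) * D := by
      rw [derivative_prod_finset, hD, Finset.mul_sum]
      refine Finset.sum_congr rfl fun j _ => ?_
      rw [derivative_pow_succ]
      have h1 : (∏ j' ∈ univ.erase j, f j' ^ (γ j' + 1)) * f j ^ γ j =
          (∏ j', f j' ^ γ j') * ∏ j' ∈ univ.erase j, f j' := by
        rw [← Finset.prod_erase_mul univ (fun j' => f j' ^ γ j') (mem_univ j)]
        simp only [pow_succ, Finset.prod_mul_distrib]
        ring
      calc (∏ j' ∈ univ.erase j, f j' ^ (γ j' + 1)) * (C ((γ j : ℝ) + 1) * f j ^ γ j *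
              derivative (f j))
          = ((∏ j' ∈ univ.erase j, f j' ^ (γ j' + 1)) * f j ^ γ j) *
              (C ((γ j : ℝ) + 1) * derivative (f j)) := by ring
        _ = (∏ j', f j' ^ γ j') * (C ((γ j : ℝ) + 1) * (∏ j' ∈ univ.erase j, f j') *
              derivative (f j)) := by rw [h1]; ring
    have hsplit : (∏ j, f j ^ (γ j + 1)) = (∏ j, f j ^ γ j) * ∏ j, f j := by
      simp only [pow_succ, Finset.prod_mul_distrib]
    rw [derivative_mul, hder, hsplit]
    ring

/-- Iterating the Leibniz step: `((Π_j f_j^{γ_j+r}) · Q)^{(r)} = (Π_j f_j^{γ_j}) · Q_r` with `Q_r`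
of class `(d + r·m, e + r)` when `Q` is of class `(d,e)`.
[cite: KoiranPortierTavenas2015, proof of Thm. 12 (p0007:L1–9, the polynomials `T_{u,v}`)] -/
theorem iterate_derivative_prod_pow_add_mul (A : Finset ℕ) (f : κ → ℝ[X])
    (hfA : ∀ j, ∀ n ∈ (f j).support, n ∈ A) (r : ℕ) :
    ∀ (γ : κ → ℕ) (Q : ℝ[X]) (d e : ℕ),
      (∀ n ∈ Q.support, n + e ∈ (A.finsuppAntidiag d).image fun c => ∑ a ∈ A, c a * a) →
      ∃ Q' : ℝ[X], (∀ n ∈ Q'.support, n + (e + r) ∈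
          (A.finsuppAntidiag (d + r * Fintype.card κ)).image fun c => ∑ a ∈ A, c a * a) ∧
        derivative^[r] ((∏ j, f j ^ (γ j + r)) * Q) = (∏ j, f j ^ γ j) * Q' := by
  induction r with
  | zero =>
    intro γ Q d e hQ
    exact ⟨Q, by simpa using hQ, by simp⟩
  | succ r ih =>
    intro γ Q d e hQ
    obtain ⟨Q₁, hQ₁, h₁⟩ := derivative_prod_pow_succ_mul A f hfA (fun j => γ j + r) Q hQ
    obtain ⟨Q₂, hQ₂, h₂⟩ := ih γ Q₁ (d + Fintype.card κ) (e + 1) hQ₁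
    refine ⟨Q₂, ?_, ?_⟩
    · have hd : d + Fintype.card κ + r * Fintype.card κ = d + (r + 1) * Fintype.card κ := by ring
      have he : e + 1 + r = e + (r + 1) := by ring
      rw [← hd, ← he]
      exact hQ₂
    · rw [Function.iterate_succ_apply]
      have : (∏ j, f j ^ (γ j + (r + 1))) = ∏ j, f j ^ (γ j + r + 1) := by
        simp only [add_assoc]
      rw [this, h₁]
      exact h₂

/-- **The Wronskian factorisation** (p0007:L20–24: "`W(g_1,…,g_s) =
(Π_{i≤s} Π_j f_j^{α_ij+N+k−i+1}) · det(T_{u,v})`"): for `q_u = b_u · Π_j f_j^{β_uj + N}`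
(`u < s ≤ N + 1`), the polynomial Wronskian `det((q_u)^{(v)})_{v,u<s}` equals
`(Π_u Π_j f_j^{β_uj}) · (Π_j f_j)^{N'} · D` for some `N'` and some `D` of class
`(m·C(s,2), C(s,2))`. [cite: KoiranPortierTavenas2015, proof of Thm. 12 (p0007:L11–30)] -/
theorem wronskian_det_factorisation (A : Finset ℕ) (f : κ → ℝ[X])
    (hfA : ∀ j, ∀ n ∈ (f j).support, n ∈ A) (s N : ℕ) (hN : s ≤ N + 1)
    (b : Fin s → ℝ) (β : Fin s → κ → ℕ) (q : Fin s → ℝ[X])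
    (hq : ∀ u, q u = C (b u) * ∏ j, f j ^ (β u j + N)) :
    ∃ (D : ℝ[X]) (N' : ℕ),
      (∀ n ∈ D.support, n + s.choose 2 ∈
        (A.finsuppAntidiag (Fintype.card κ * s.choose 2)).image fun c => ∑ a ∈ A, c a * a) ∧
      Matrix.det (Matrix.of fun v u : Fin s => derivative^[(v : ℕ)] (q u)) =
        (∏ u, ∏ j, f j ^ β u j) * (∏ j, f j) ^ N' * D := by
  classical
  -- entrywise factorisation
  have hentry : ∀ u v : Fin s, ∃ Quv : ℝ[X], (∀ n ∈ Quv.support, n + (v : ℕ) ∈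
      (A.finsuppAntidiag ((v : ℕ) * Fintype.card κ)).image fun c => ∑ a ∈ A, c a * a) ∧
      derivative^[(v : ℕ)] (q u) = (∏ j, f j ^ (β u j + (N - v))) * Quv := by
    intro u v
    have hv : (v : ℕ) ≤ N := by have := v.2; omega
    obtain ⟨Q', hQ', h'⟩ := iterate_derivative_prod_pow_add_mul A f hfA v
      (fun j => β u j + (N - v)) (C (b u)) 0 0 (sumClass_C A (b u))
    refine ⟨Q', by simpa using hQ', ?_⟩
    rw [hq u, mul_comm (C (b u))]
    have : (∏ j, f j ^ (β u j + N)) = ∏ j, f j ^ (β u j + (N - v) + v) := by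
      refine Finset.prod_congr rfl fun j _ => ?_
      congr 1
      omega
    rw [this]
    exact h'
  choose Qm hQm hfac using hentry
  refine ⟨Matrix.det (Matrix.of fun v u : Fin s => Qm u v), ∑ v : Fin s, (N - (v : ℕ)), ?_, ?_⟩
  · -- the class of `det (Qm u v)`: every permutation product has class (m·C(s,2), C(s,2))
    rw [Matrix.det_apply]
    refine sumClass_sum _ _ fun σ _ => ?_
    have hsumσ : ∑ i : Fin s, ((σ i : Fin s) : ℕ) = s.choose 2 := by
      rw [Equiv.sum_comp σ (fun i : Fin s => (i : ℕ)), Fin.sum_univ_eq_sum_range (fun i => i) s,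
        Finset.sum_range_id, Nat.choose_two_right]
    have hprod : ∀ n ∈ (∏ i : Fin s, (Matrix.of fun v u : Fin s => Qm u v) (σ i) i).support,
        n + s.choose 2 ∈ (A.finsuppAntidiag (Fintype.card κ * s.choose 2)).image
          fun c => ∑ a ∈ A, c a * a := by
      refine sumClass_prod univ _ (fun i => ((σ i : Fin s) : ℕ) * Fintype.card κ)
        (fun i => ((σ i : Fin s) : ℕ)) (fun i _ => ?_) ?_ hsumσ
      · simpa only [Matrix.of_apply] using hQm i (σ i)
      · rw [← Finset.sum_mul, hsumσ, mul_comm]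
    rcases Int.units_eq_one_or (Equiv.Perm.sign σ) with hσ | hσ
    · rw [hσ, one_smul]
      exact hprod
    · rw [hσ, Units.smul_def, Units.val_neg, Units.val_one, neg_smul, one_smul]
      exact sumClass_neg hprod
  · -- pulling the factors out of columns and rows
    have hM : (Matrix.of fun v u : Fin s => derivative^[(v : ℕ)] (q u)) =
        Matrix.of fun v u : Fin s => (∏ j, f j ^ β u j) *
          (Matrix.of fun v u : Fin s => (∏ j, f j) ^ (N - (v : ℕ)) *
            (Matrix.of fun v u : Fin s => Qm u v) v u) v u := by
      ext v u
      simp only [Matrix.of_apply]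
      rw [hfac u v]
      have : (∏ j, f j ^ (β u j + (N - (v : ℕ)))) =
          (∏ j, f j ^ β u j) * (∏ j, f j) ^ (N - (v : ℕ)) := by
        rw [← Finset.prod_pow, ← Finset.prod_mul_distrib]
        simp only [pow_add]
      rw [this, mul_assoc]
    rw [hM, Matrix.det_mul_row, Matrix.det_mul_column, Finset.prod_pow_eq_pow_sum]
    ring

/-- **Zeros of the Wronskian** (p0007:L18–30 and L49, formula (Borne_zeros) and Descartes' rule):
in the situation of `wronskian_det_factorisation`, if the `f_j` are non-zero with at most `t`
monomials each and the Wronskian is not the zero polynomial, then it has at most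
`m(2t−1) + 2·C(mt + m·C(s,2) − 1, m·C(s,2)) − 1` distinct real roots ("`Z(W(g_1,…,g_s)) ≤
Σ_j Z(f_j) + Z(det T_{u,v})`", "`Z(det T_{u,v}) ≤ 2 C(m C(s,2) + mt − 1, mt − 1) − 1`", and
"`Σ_j Z(f_j) ≤ (2t − 1) m`" by the weak rule of signs, the tree's
`card_roots_toFinset_le_of_card_support`). Subtraction-free `ℕ` form of the constants.
[cite: KoiranPortierTavenas2015, proof of Thm. 12 (p0007:L18–50)] -/
theorem card_roots_wronskian_det_le (f : κ → ℝ[X]) (hf : ∀ j, f j ≠ 0) (t : ℕ)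
    (ht : ∀ j, (f j).support.card ≤ t) (s N : ℕ) (hN : s ≤ N + 1)
    (b : Fin s → ℝ) (β : Fin s → κ → ℕ) (q : Fin s → ℝ[X])
    (hq : ∀ u, q u = C (b u) * ∏ j, f j ^ (β u j + N))
    (hW : Matrix.det (Matrix.of fun v u : Fin s => derivative^[(v : ℕ)] (q u)) ≠ 0) :
    (Matrix.det (Matrix.of fun v u : Fin s => derivative^[(v : ℕ)] (q u))).roots.toFinset.card ≤
      Fintype.card κ * (2 * (t - 1) + 1) +
        (2 * (((Fintype.card κ) * t + Fintype.card κ * s.choose 2 - 1).choose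
          (Fintype.card κ * s.choose 2) - 1) + 1) := by
  classical
  set A : Finset ℕ := univ.biUnion fun j => (f j).support with hA
  have hfA : ∀ j, ∀ n ∈ (f j).support, n ∈ A :=
    fun j n hn => mem_biUnion.mpr ⟨j, mem_univ j, hn⟩
  have hAcard : A.card ≤ Fintype.card κ * t :=
    card_biUnion_le.trans (by simpa using Finset.sum_le_sum fun j (_ : j ∈ univ) => ht j)
  obtain ⟨D, N', hD, hfacW⟩ := wronskian_det_factorisation A f hfA s N hN b β q hq
  rw [hfacW] at hW ⊢
  have hD0 : D ≠ 0 := right_ne_zero_of_mul hW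
  -- roots of the product ⊆ (⋃_j roots f_j) ∪ roots D
  have hsub : ((∏ u, ∏ j, f j ^ β u j) * (∏ j, f j) ^ N' * D).roots.toFinset ⊆
      (univ.biUnion fun j => (f j).roots.toFinset) ∪ D.roots.toFinset := by
    intro x hx
    rw [Multiset.mem_toFinset, mem_roots hW, IsRoot.def, eval_mul, eval_mul] at hx
    rw [mem_union, mem_biUnion, Multiset.mem_toFinset, mem_roots hD0, IsRoot.def]
    rcases mul_eq_zero.mp hx with h12 | h3
    · left
      rcases mul_eq_zero.mp h12 with h1 | h2
      · rw [eval_prod] at h1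
        obtain ⟨u, -, hu⟩ := Finset.prod_eq_zero_iff.mp h1
        rw [eval_prod] at hu
        obtain ⟨j, -, hj⟩ := Finset.prod_eq_zero_iff.mp hu
        rw [eval_pow] at hj
        exact ⟨j, mem_univ j, by
          rw [Multiset.mem_toFinset, mem_roots (hf j), IsRoot.def]
          exact (pow_eq_zero_iff'.mp hj).1⟩
      · rw [eval_pow] at h2
        have h2' := (pow_eq_zero_iff'.mp h2).1
        rw [eval_prod] at h2'
        obtain ⟨j, -, hj⟩ := Finset.prod_eq_zero_iff.mp h2'
        exact ⟨j, mem_univ j, by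
          rw [Multiset.mem_toFinset, mem_roots (hf j), IsRoot.def]
          exact hj⟩
    · right
      exact h3
  -- Descartes' weak rule of signs for each factor
  have hfj : ∀ j, (f j).roots.toFinset.card ≤ 2 * (t - 1) + 1 := fun j =>
    (card_roots_toFinset_le_of_card_support (hf j)).trans (by have := ht j; omega)
  have hDcard : D.support.card ≤
      ((Fintype.card κ) * t + Fintype.card κ * s.choose 2 - 1).choose
        (Fintype.card κ * s.choose 2) := card_support_le_of_sumClass hD hAcard
  have hDroots : D.roots.toFinset.card ≤
      2 * (((Fintype.card κ) * t + Fintype.card κ * s.choose 2 - 1).choose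
        (Fintype.card κ * s.choose 2) - 1) + 1 :=
    (card_roots_toFinset_le_of_card_support hD0).trans (by omega)
  calc _ ≤ ((univ.biUnion fun j => (f j).roots.toFinset) ∪ D.roots.toFinset).card :=
        card_le_card hsub
    _ ≤ (univ.biUnion fun j => (f j).roots.toFinset).card + D.roots.toFinset.card :=
        card_union_le _ _
    _ ≤ (∑ j, (f j).roots.toFinset.card) + D.roots.toFinset.card := by
        gcongr
        exact card_biUnion_le
    _ ≤ Fintype.card κ * (2 * (t - 1) + 1) +
        (2 * (((Fintype.card κ) * t + Fintype.card κ * s.choose 2 - 1).choose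
          (Fintype.card κ * s.choose 2) - 1) + 1) := by
        gcongr with j
        · calc (∑ j, (f j).roots.toFinset.card) ≤ ∑ _j : κ, (2 * (t - 1) + 1) :=
              sum_le_sum fun j _ => hfj j
            _ = Fintype.card κ * (2 * (t - 1) + 1) := by simp

/-- Degree version of `card_roots_wronskian_det_le` (proof of Theorem 13, p0007:L73–80: "it is of
degree `md·C(s,2)` in the variable `x` … the first term is bounded by `md` and the second one by
`md·C(s,2)`"): if every `f_j` is non-zero of degree `≤ δ`, the Wronskian has at most
`m·δ + m·δ·C(s,2)` distinct real roots. [cite: KoiranPortierTavenas2015, proof of Thm. 13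
(p0007:L73–80)] -/
theorem card_roots_wronskian_det_le_of_degree (f : κ → ℝ[X]) (hf : ∀ j, f j ≠ 0) (δ : ℕ)
    (hδ : ∀ j, (f j).natDegree ≤ δ) (s N : ℕ) (hN : s ≤ N + 1)
    (b : Fin s → ℝ) (β : Fin s → κ → ℕ) (q : Fin s → ℝ[X])
    (hq : ∀ u, q u = C (b u) * ∏ j, f j ^ (β u j + N))
    (hW : Matrix.det (Matrix.of fun v u : Fin s => derivative^[(v : ℕ)] (q u)) ≠ 0) :
    (Matrix.det (Matrix.of fun v u : Fin s => derivative^[(v : ℕ)] (q u))).roots.toFinset.card ≤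
      Fintype.card κ * δ + Fintype.card κ * δ * s.choose 2 := by
  classical
  set A : Finset ℕ := univ.biUnion fun j => (f j).support with hA
  have hfA : ∀ j, ∀ n ∈ (f j).support, n ∈ A :=
    fun j n hn => mem_biUnion.mpr ⟨j, mem_univ j, hn⟩
  have hAδ : ∀ a ∈ A, a ≤ δ := by
    intro a ha
    obtain ⟨j, -, hj⟩ := mem_biUnion.mp ha
    exact (le_natDegree_of_mem_supp a hj).trans (hδ j)
  obtain ⟨D, N', hD, hfacW⟩ := wronskian_det_factorisation A f hfA s N hN b β q hq
  rw [hfacW] at hW ⊢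
  have hD0 : D ≠ 0 := right_ne_zero_of_mul hW
  have hsub : ((∏ u, ∏ j, f j ^ β u j) * (∏ j, f j) ^ N' * D).roots.toFinset ⊆
      (univ.biUnion fun j => (f j).roots.toFinset) ∪ D.roots.toFinset := by
    intro x hx
    rw [Multiset.mem_toFinset, mem_roots hW, IsRoot.def, eval_mul, eval_mul] at hx
    rw [mem_union, mem_biUnion, Multiset.mem_toFinset, mem_roots hD0, IsRoot.def]
    rcases mul_eq_zero.mp hx with h12 | h3
    · left
      rcases mul_eq_zero.mp h12 with h1 | h2
      · rw [eval_prod] at h1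
        obtain ⟨u, -, hu⟩ := Finset.prod_eq_zero_iff.mp h1
        rw [eval_prod] at hu
        obtain ⟨j, -, hj⟩ := Finset.prod_eq_zero_iff.mp hu
        rw [eval_pow] at hj
        exact ⟨j, mem_univ j, by
          rw [Multiset.mem_toFinset, mem_roots (hf j), IsRoot.def]
          exact (pow_eq_zero_iff'.mp hj).1⟩
      · rw [eval_pow] at h2
        have h2' := (pow_eq_zero_iff'.mp h2).1
        rw [eval_prod] at h2'
        obtain ⟨j, -, hj⟩ := Finset.prod_eq_zero_iff.mp h2'
        exact ⟨j, mem_univ j, by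
          rw [Multiset.mem_toFinset, mem_roots (hf j), IsRoot.def]
          exact hj⟩
    · right
      exact h3
  have hfj : ∀ j, (f j).roots.toFinset.card ≤ δ := fun j =>
    (Multiset.toFinset_card_le _).trans ((card_roots' (f j)).trans (hδ j))
  have hDdeg : D.natDegree ≤ Fintype.card κ * s.choose 2 * δ - s.choose 2 :=
    natDegree_le_of_sumClass hD hAδ
  have hDroots : D.roots.toFinset.card ≤ Fintype.card κ * δ * s.choose 2 :=
    (Multiset.toFinset_card_le _).trans ((card_roots' D).trans (hDdeg.trans (by
      rw [Nat.mul_right_comm]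
      omega)))
  calc _ ≤ ((univ.biUnion fun j => (f j).roots.toFinset) ∪ D.roots.toFinset).card :=
        card_le_card hsub
    _ ≤ (univ.biUnion fun j => (f j).roots.toFinset).card + D.roots.toFinset.card :=
        card_union_le _ _
    _ ≤ (∑ j, (f j).roots.toFinset.card) + D.roots.toFinset.card := by
        gcongr
        exact card_biUnion_le
    _ ≤ Fintype.card κ * δ + Fintype.card κ * δ * s.choose 2 := by
        gcongr with j
        · calc (∑ j, (f j).roots.toFinset.card) ≤ ∑ _j : κ, δ := sum_le_sum fun j _ => hfj j
            _ = Fintype.card κ * δ := by simp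

end Factorisation

/-! ### Reduction to a linearly independent sub-family (p0006:L76–78) -/

/-- "We can assume without loss of generality that the family `(g_i)` is linearly independent.
Indeed, if it is not the case, we can consider a basis of the family `(g_i)` and write `f̃` in this
basis. Then we can suppose that all `a_i` are non-zero, otherwise, we remove these terms from the
sum" (p0006:L76–78): a non-zero linear combination of a finite family is a linear combination,
with non-zero coefficients, of a linearly independent sub-family (Mathlib's
`exists_linearIndependent'`, then the zero coefficients are dropped).
[cite: KoiranPortierTavenas2015, proof of Thm. 12 (p0006:L76–78)] -/
theorem exists_linearIndependent_subfamily {ι V : Type*} [Fintype ι] [AddCommGroup V]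
    [Module ℝ V] (g : ι → V) (a : ι → ℝ) (hw : ∑ i, a i • g i ≠ 0) :
    ∃ (s₀ : ℕ) (idx : Fin s₀ → ι) (c : Fin s₀ → ℝ), 1 ≤ s₀ ∧ s₀ ≤ Fintype.card ι ∧
      Function.Injective idx ∧ (∀ n, c n ≠ 0) ∧ LinearIndependent ℝ (g ∘ idx) ∧
      ∑ n, c n • g (idx n) = ∑ i, a i • g i := by
  classical
  obtain ⟨κ', emb, hinj, hspan, hli⟩ := exists_linearIndependent' (K := ℝ) g
  haveI : Fintype κ' := Fintype.ofInjective emb hinj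
  have hmem : ∑ i, a i • g i ∈ Submodule.span ℝ (Set.range (g ∘ emb)) := by
    rw [hspan]
    exact Submodule.sum_mem _ fun i _ =>
      Submodule.smul_mem _ _ (Submodule.subset_span (Set.mem_range_self i))
  obtain ⟨c₀, hc₀⟩ := (Submodule.mem_span_range_iff_exists_fun ℝ).mp hmem
  set S : Finset κ' := univ.filter fun x => c₀ x ≠ 0 with hS
  refine ⟨S.card, fun n => emb (S.equivFin.symm n), fun n => c₀ (S.equivFin.symm n),
    ?_, ?_, ?_, ?_, ?_, ?_⟩
  · -- `1 ≤ |S|`: otherwise all coefficients vanish and the combination is `0`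
    by_contra h
    have hS0 : S = ∅ := by
      rw [← Finset.card_eq_zero]
      omega
    apply hw
    rw [← hc₀]
    refine Finset.sum_eq_zero fun x _ => ?_
    have hx : c₀ x = 0 := by
      by_contra hx
      have : x ∈ S := by simp [hS, hx]
      rw [hS0] at this
      exact absurd this (Finset.notMem_empty x)
    simp [hx]
  · calc S.card ≤ Fintype.card κ' := Finset.card_le_univ S
      _ ≤ Fintype.card ι := Fintype.card_le_of_injective emb hinj
  · exact hinj.comp (Subtype.val_injective.comp S.equivFin.symm.injective)
  · intro n
    have := (S.equivFin.symm n).2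
    simp only [hS, Finset.mem_filter] at this
    exact this.2
  · exact hli.comp _ (Subtype.val_injective.comp S.equivFin.symm.injective)
  · rw [← hc₀]
    have h1 : ∑ n : Fin S.card, c₀ (S.equivFin.symm n) • g (emb (S.equivFin.symm n)) =
        ∑ x : S, c₀ x • g (emb x) :=
      Equiv.sum_comp S.equivFin.symm (fun x : S => c₀ x • g (emb x))
    rw [h1, Finset.sum_coe_sort S (fun x => c₀ x • g (emb x)), hS, Finset.sum_filter_of_ne]
    · rfl
    · intro x _ hx h0
      exact hx (by simp [h0])

/-! ### The common skeleton of Theorems 12 and 13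

Multiply `f = Σ_i a_i Π_j f_j^{α_ij}` by `(Π_j f_j)^{k−1}` (the printed `f̃ = f · Π_j f_j^{N+k}`,
with `N = 0` for natural exponents, p0006:L73–75), pass to a linearly independent sub-family with
non-zero coefficients (`s₀ ≤ k` terms), bound `Z(f̃)` by Theorem 9 (`KPT2015_thm_9_real`), the
Wronskians being non-zero by Lemma 5 (`KPT2015_lemma_5_real`, Bôcher), and bound the zeros of
each Wronskian `W_s`, `1 ≤ s ≤ s₀`, by a given function `Bf s` (p0007:L31–47: "`Z(f) ≤
Z(Σ a_i g_i) ≤ k − 1 + 2 Σ_{s=1}^{k} Z(W(g_1, …, g_s))`"). -/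

/-- The skeleton of the proofs of Theorems 12 and 13: if every non-zero polynomial Wronskian
`det((q_u)^{(v)})_{v,u<s}` of `s ≤ k` polynomials of the form `q_u = b_u Π_j f_j^{β_uj + (k−1)}`
has at most `Bf s` distinct real roots, then `f = Σ_{i} a_i Π_j f_j^{α_ij} ≠ 0` (`k` terms, all
`f_j ≠ 0`) has at most `k − 1 + 2 Σ_{s=1}^{k} Bf s` distinct real roots.
[cite: KoiranPortierTavenas2015, proof of Thm. 12 (p0006:L72–78, p0007:L31–47)] -/
theorem card_roots_sum_prod_pow_le_of_wronskian_bound {ι κ : Type*} [Fintype ι] [Fintype κ]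
    (f : κ → ℝ[X]) (hf : ∀ j, f j ≠ 0) (a : ι → ℝ) (α : ι → κ → ℕ)
    (hP : ∑ i, C (a i) * ∏ j, f j ^ α i j ≠ 0) (Bf : ℕ → ℕ)
    (hBf : ∀ (s : ℕ), s ≤ Fintype.card ι - 1 + 1 → ∀ (b : Fin s → ℝ) (β : Fin s → κ → ℕ)
      (q : Fin s → ℝ[X]), (∀ u, q u = C (b u) * ∏ j, f j ^ (β u j + (Fintype.card ι - 1))) →
      Matrix.det (Matrix.of fun v u : Fin s => derivative^[(v : ℕ)] (q u)) ≠ 0 →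
      (Matrix.det (Matrix.of fun v u : Fin s =>
        derivative^[(v : ℕ)] (q u))).roots.toFinset.card ≤ Bf s) :
    (∑ i, C (a i) * ∏ j, f j ^ α i j).roots.toFinset.card ≤
      (Fintype.card ι - 1) + 2 * ∑ s ∈ Icc 1 (Fintype.card ι), Bf s := by
  classical
  set k := Fintype.card ι with hk
  set P := ∑ i, C (a i) * ∏ j, f j ^ α i j with hPdef
  -- `k ≥ 1`
  have hk1 : 1 ≤ k := by
    rw [Nat.one_le_iff_ne_zero]
    intro h0
    haveI : IsEmpty ι := Fintype.card_eq_zero_iff.mp h0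
    exact hP (by simp [hPdef])
  -- the padded combination `P̃ = (Π_j f_j)^N · P = Σ_i a_i g_i`
  set N := k - 1 with hN
  set g : ι → ℝ[X] := fun i => ∏ j, f j ^ (α i j + N) with hg
  set Pt : ℝ[X] := (∏ j, f j) ^ N * P with hPt
  have hPt_eq : Pt = ∑ i, a i • g i := by
    rw [hPt, hPdef, Finset.mul_sum]
    refine Finset.sum_congr rfl fun i _ => ?_
    rw [smul_eq_C_mul, hg]
    simp only [pow_add, Finset.prod_mul_distrib, Finset.prod_pow]
    ring
  have hPt_ne : Pt ≠ 0 :=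
    mul_ne_zero (pow_ne_zero _ (Finset.prod_ne_zero_iff.mpr fun j _ => hf j)) hP
  have hsub : P.roots.toFinset ⊆ Pt.roots.toFinset := by
    intro x hx
    rw [Multiset.mem_toFinset, mem_roots hP, IsRoot.def] at hx
    rw [Multiset.mem_toFinset, mem_roots hPt_ne, IsRoot.def, hPt, eval_mul, hx, mul_zero]
  -- linearly independent sub-family with non-zero coefficients
  have hw : ∑ i, a i • g i ≠ 0 := by rwa [← hPt_eq]
  obtain ⟨s₀, idx, c, hs₀, hs₀k, -, hc, hli, hsum⟩ :=
    exists_linearIndependent_subfamily g a hw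
  -- the `ℕ`-indexed family fed to Theorem 9, and its polynomial Wronskians
  set p : ℕ → ℝ[X] := fun n => if h : n < s₀ then C (c ⟨n, h⟩) * g (idx ⟨n, h⟩) else 0
    with hp
  set F : ℕ → ℝ → ℝ := fun n x => (p n).eval x with hF
  set W : ℕ → ℝ[X] := fun j' =>
    Matrix.det (Matrix.of fun v u : Fin j' => derivative^[(v : ℕ)] (p u)) with hWdef
  have hp_of_lt : ∀ (n : ℕ) (h : n < s₀),
      p n = C (c ⟨n, h⟩) * ∏ j, f j ^ (α (idx ⟨n, h⟩) j + N) := by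
    intro n h
    simp only [hp, dif_pos h, hg]
  have hF_an : ∀ i < s₀, ∀ x : ℝ, AnalyticAt ℝ (F i) x := fun i _ x =>
    (AnalyticOnNhd.eval_polynomial (𝕜 := ℝ) (p i)) x (Set.mem_univ x)
  -- `Σ_{n<s₀} F n = P̃` as functions
  have hsumF : (fun x => ∑ i ∈ Finset.range s₀, F i x) = fun x => Pt.eval x := by
    funext x
    simp only [hF]
    rw [← eval_finsetSum, Finset.sum_range (fun i => p i)]
    congr 1
    rw [hPt_eq, ← hsum]
    refine Finset.sum_congr rfl fun n _ => ?_
    rw [hp_of_lt n n.2]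
    simp only [Fin.eta, smul_eq_C_mul, hg]
  -- the Wronskians as polynomial functions
  have hWF : ∀ j', wronskian F j' = fun x => (W j').eval x := by
    intro j'
    funext x
    simp only [hF, hWdef]
    exact wronskian_eval_poly p j' x
  -- the Wronskians `W_{j'}`, `j' ≤ s₀`, are not the zero polynomial (Lemma 5, Bôcher)
  have hWne : ∀ j', j' ≤ s₀ → W j' ≠ 0 := by
    intro j' hj' hdet
    have hW0 : wronskian F j' = 0 := by
      rw [hWF j']
      funext x
      rw [hdet, eval_zero, Pi.zero_apply]
    obtain ⟨a', ⟨i₀, hi₀, ha'⟩, hrel⟩ :=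
      (KPT2015_lemma_5_real j' F fun i hi x => hF_an i (by omega) x).mpr hW0
    -- the relation is a polynomial identity
    have hpoly : ∑ i ∈ Finset.range j', C (a' i) * p i = 0 := by
      apply Polynomial.funext
      intro x
      have := congrFun hrel x
      simp only [hF, Pi.zero_apply] at this
      rw [eval_finsetSum, eval_zero]
      simpa [eval_mul, eval_C] using this
    -- transported to the linearly independent family `g ∘ idx`
    have hrel' : ∑ n : Fin s₀, (if (n : ℕ) < j' then a' n * c n else 0) • g (idx n) = 0 := by
      calc ∑ n : Fin s₀, (if (n : ℕ) < j' then a' n * c n else 0) • g (idx n)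
          = ∑ i ∈ Finset.range s₀, (if i < j' then C (a' i) * p i else 0) := by
            rw [Finset.sum_range]
            refine Finset.sum_congr rfl fun n _ => ?_
            split_ifs with h
            · rw [hp_of_lt n n.2]
              simp only [Fin.eta, smul_eq_C_mul, C_mul, mul_assoc, hg]
            · simp
        _ = ∑ i ∈ Finset.range j', C (a' i) * p i := by
            rw [← Finset.sum_filter]
            congr 1
            ext i
            simp only [Finset.mem_filter, Finset.mem_range]
            omega
        _ = 0 := hpoly
    have hzero := (Fintype.linearIndependent_iff.mp hli) _ hrel' ⟨i₀, by omega⟩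
    simp only [hi₀, if_true] at hzero
    exact ha' ((mul_eq_zero.mp hzero).resolve_right (hc _))
  -- root counts of the Wronskians `W_1, …, W_{s₀}`
  have hWcard : ∀ j', 1 ≤ j' → j' ≤ s₀ → (W j').roots.toFinset.card ≤ Bf j' := by
    intro j' _ hj'
    exact hBf j' (by omega) (fun u => c ⟨u, by omega⟩) (fun u => α (idx ⟨u, by omega⟩))
      (fun u => p u) (fun u => hp_of_lt u (by omega)) (hWne j' hj')
  have hrz : ∀ j', j' ≤ s₀ → realZeros (wronskian F j') = ((W j').roots.toFinset.card : ℕ∞) := by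
    intro j' hj'
    rw [hWF j', realZeros_eval_poly (hWne j' hj')]
  -- Theorem 9
  have h9 := KPT2015_thm_9_real s₀ hs₀ F hF_an
  have hsum9 : ∑ j ∈ Finset.Icc 1 (s₀ - 2), realZeros (wronskian F j) =
      ∑ j ∈ Finset.Icc 1 (s₀ - 2), ((W j).roots.toFinset.card : ℕ∞) :=
    Finset.sum_congr rfl fun j hj => hrz j (by simp only [Finset.mem_Icc] at hj; omega)
  rw [hsumF, realZeros_eval_poly hPt_ne, hrz s₀ le_rfl, hrz (s₀ - 1) (by omega), hsum9] at h9
  norm_cast at h9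
  -- collect: `Z(P̃) ≤ (s₀ − 1) + 2 Σ_{j=1}^{s₀} Bf j`
  have hcB : ∀ j ∈ Icc 1 s₀, (W j).roots.toFinset.card ≤ Bf j := fun j hj => by
    simp only [Finset.mem_Icc] at hj
    exact hWcard j hj.1 hj.2
  have hmain : Pt.roots.toFinset.card ≤ (s₀ - 1) + 2 * ∑ j ∈ Icc 1 s₀, Bf j := by
    rcases Nat.lt_or_ge s₀ 2 with h2 | h2
    · -- `s₀ = 1`
      obtain rfl : s₀ = 1 := by omega
      have h0 : (W 0).roots.toFinset.card = 0 := by simp [hWdef]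
      have h1 : (W 1).roots.toFinset.card ≤ Bf 1 := hcB 1 (by simp)
      simp only [Nat.sub_self, h0, add_zero, zero_add,
        show Icc 1 0 = ∅ from rfl, Finset.sum_empty, mul_zero] at h9
      simp only [Nat.sub_self, zero_add, Finset.Icc_self, Finset.sum_singleton]
      omega
    · -- `s₀ ≥ 2`: split off the two top terms of `Σ_{j=1}^{s₀} Bf j`
      have hsplit : ∑ j ∈ Icc 1 s₀, Bf j =
          (∑ j ∈ Icc 1 (s₀ - 2), Bf j) + Bf (s₀ - 1) + Bf s₀ := by
        obtain ⟨r, rfl⟩ : ∃ r, s₀ = r + 2 := ⟨s₀ - 2, by omega⟩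
        rw [Finset.sum_Icc_succ_top (by omega), Finset.sum_Icc_succ_top (by omega)]
        simp only [Nat.add_sub_cancel, show r + 2 - 1 = r + 1 from rfl]
      have hle : ∑ j ∈ Icc 1 (s₀ - 2), (W j).roots.toFinset.card ≤
          ∑ j ∈ Icc 1 (s₀ - 2), Bf j :=
        Finset.sum_le_sum fun j hj => hcB j (by
          simp only [Finset.mem_Icc] at hj ⊢
          omega)
      have h_s : (W s₀).roots.toFinset.card ≤ Bf s₀ := hcB s₀ (by simp; omega)
      have h_s1 : (W (s₀ - 1)).roots.toFinset.card ≤ Bf (s₀ - 1) := hcB (s₀ - 1) (by simp; omega)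
      rw [hsplit]
      omega
  calc P.roots.toFinset.card ≤ Pt.roots.toFinset.card := Finset.card_le_card hsub
    _ ≤ (s₀ - 1) + 2 * ∑ j ∈ Icc 1 s₀, Bf j := hmain
    _ ≤ (k - 1) + 2 * ∑ j ∈ Icc 1 k, Bf j := by
      gcongr ?_ + 2 * ?_
      · omega
      · exact Finset.sum_le_sum_of_subset (Finset.Icc_subset_Icc_right hs₀k)

/-! ### Theorem 12 -/

/-- **KPT 2015, Theorem 12 — the intermediate bound of its proof** (p0007:L49–54: "`Z(f) ≤
k − 1 + 2k(2t−1)m + 2 Σ_{s=1}^{k} (2 C(m C(s,2) + mt − 1, mt − 1) − 1)`"), for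
`f = Σ_{i} a_i Π_j f_j^{α_ij} ≠ 0` with `k = |ι|` terms and `m = |κ|` NON-ZERO polynomials `f_j`
with at most `t` monomials each; distinct real roots counted by `roots.toFinset.card`. Written
subtraction-free in `ℕ` (`m(2(t−1)+1) = m(2t−1)` and `2(C−1)+1 = 2C−1` as `t, C ≥ 1`), with the
binomial coefficient in the symmetric form `C(mt + mC(s,2) − 1, mC(s,2))`. The zero-`f_j` case
and the printed closed form are `KPT2015_thm_12`.
[cite: KoiranPortierTavenas2015, Thm. 12 (proof, p0007:L49–54)] -/
theorem KPT2015_thm_12_combinatorial {ι κ : Type*} [Fintype ι] [Fintype κ]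
    (f : κ → ℝ[X]) (hf : ∀ j, f j ≠ 0) (t : ℕ) (ht : ∀ j, (f j).support.card ≤ t)
    (a : ι → ℝ) (α : ι → κ → ℕ) (hP : ∑ i, C (a i) * ∏ j, f j ^ α i j ≠ 0) :
    (∑ i, C (a i) * ∏ j, f j ^ α i j).roots.toFinset.card ≤
      (Fintype.card ι - 1) + 2 * ∑ s ∈ Icc 1 (Fintype.card ι),
        (Fintype.card κ * (2 * (t - 1) + 1) +
          (2 * ((Fintype.card κ * t + Fintype.card κ * s.choose 2 - 1).choose
            (Fintype.card κ * s.choose 2) - 1) + 1)) := by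
  classical
  exact card_roots_sum_prod_pow_le_of_wronskian_bound f hf a α hP _
    fun s hs b β q hq hW => card_roots_wronskian_det_le f hf t ht s _ hs b β q hq hW

/-! ### The closed forms: elementary estimates -/

/-- `k + 2·C(k,2) = k²`. [folklore] -/
private theorem add_two_mul_choose_two_eq_sq (k : ℕ) : k + 2 * k.choose 2 = k ^ 2 := by
  induction k with
  | zero => simp
  | succ k ih =>
    rw [Nat.choose_succ_succ, Nat.choose_one_right]
    nlinarith [ih]

/-- `Σ_{s=1}^{k} C(s,2) = C(k+1,3)` (hockey stick). [folklore] -/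
private theorem sum_Icc_choose_two (k : ℕ) : ∑ s ∈ Icc 1 k, s.choose 2 = (k + 1).choose 3 := by
  induction k with
  | zero => simp [Nat.choose_eq_zero_of_lt (by norm_num : 1 < 3)]
  | succ k ih =>
    rw [Finset.sum_Icc_succ_top (by omega), ih]
    change _ = (k + 1 + 1).choose (2 + 1)
    rw [Nat.choose_succ_succ (k + 1) 2, add_comm]

/-- `6·C(k+1,3) ≤ k³` (indeed `= k³ − k`). [folklore] -/
private theorem six_mul_choose_succ_three_le_cube (k : ℕ) : 6 * (k + 1).choose 3 ≤ k ^ 3 := by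
  have h1 := Nat.add_one_mul_choose_eq k 2
  have h2 := add_two_mul_choose_two_eq_sq k
  have h3 : 6 * (k + 1).choose 3 + k = k ^ 3 := by
    zify at h1 h2 ⊢
    linear_combination (-2 : ℤ) * h1 + ((k : ℤ) + 1) * h2
  omega

/-- `C(n, d) ≤ (e·n/d)^d` in the form used in print (p0007:L56: "we use the well known bound
`C(n,k) ≤ (en/k)^k`"): for `1 ≤ d` and `n ≤ d·B`, `C(n, d) ≤ (e·B)^d` (from Mathlib's
`Nat.choose_le_pow_div` and `Real.pow_div_factorial_le_exp`, i.e. `d^d/d! ≤ e^d`). [folklore] -/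
private theorem choose_le_exp_mul_pow {n d : ℕ} {B : ℝ} (hd : 1 ≤ d) (hB : (n : ℝ) ≤ d * B) :
    (n.choose d : ℝ) ≤ (Real.exp 1 * B) ^ d := by
  have hdpos : (0 : ℝ) < d := by exact_mod_cast hd
  have hB0 : 0 ≤ B := by
    have : (0 : ℝ) ≤ n := Nat.cast_nonneg n
    nlinarith
  -- `d^d ≤ e^d · d!`
  have hfac : (d : ℝ) ^ d ≤ Real.exp 1 ^ d * d.factorial := by
    have h := Real.pow_div_factorial_le_exp (d : ℝ) (le_of_lt hdpos) d
    rw [div_le_iff₀ (by positivity), ← Real.exp_one_pow] at h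
    exact h
  calc (n.choose d : ℝ) ≤ (n : ℝ) ^ d / d.factorial := Nat.choose_le_pow_div d n
    _ ≤ ((d : ℝ) * B) ^ d / d.factorial := by gcongr
    _ = B ^ d * ((d : ℝ) ^ d / d.factorial) := by rw [mul_pow]; ring
    _ ≤ B ^ d * Real.exp 1 ^ d := by
        gcongr
        rw [div_le_iff₀ (by positivity)]
        exact hfac
    _ = (Real.exp 1 * B) ^ d := by rw [mul_pow]; ring

/-- The elementary estimate closing the proof of Theorem 12 (p0007:L56–62), through
`C(mt + mC(s,2) − 1, mC(s,2)) ≤ (e(1+t))^{mC(s,2)} ≤ (e(1+t))^{mC(k,2)}` and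
`k ≤ 2^k ≤ (e(1+t))^{mk/2}`, `mk + 2mC(k,2) = mk²`: for `k, m, t ≥ 1`,
`k − 1 + 2 Σ_{s=1}^{k} (m(2t−1) + 2 C(mt + mC(s,2) − 1, mC(s,2)) − 1) ≤ 4ktm + 4 (e(1+t))^{mk²/2}`
(the print's last two displayed lines). [cite: KoiranPortierTavenas2015, proof of Thm. 12
(p0007:L56–62)] -/
theorem KPT2015_thm_12_estimate (k m t : ℕ) (hk : 1 ≤ k) (hm : 1 ≤ m) (ht : 1 ≤ t) :
    (((k - 1) + 2 * ∑ s ∈ Icc 1 k, (m * (2 * (t - 1) + 1) +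
        (2 * ((m * t + m * s.choose 2 - 1).choose (m * s.choose 2) - 1) + 1)) : ℕ) : ℝ) ≤
      4 * k * t * m + 4 * (Real.exp 1 * (1 + t)) ^ ((m * k ^ 2 : ℝ) / 2) := by
  set X : ℝ := Real.exp 1 * (1 + t) with hX
  have he : (2 : ℝ) ≤ Real.exp 1 := by
    have := Real.add_one_le_exp (1 : ℝ)
    norm_num at this ⊢
    linarith
  have ht1 : (1 : ℝ) ≤ t := by exact_mod_cast ht
  have hm1 : (1 : ℝ) ≤ m := by exact_mod_cast hm
  have hk1 : (1 : ℝ) ≤ k := by exact_mod_cast hk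
  have hX4 : 4 ≤ X := by rw [hX]; nlinarith
  have hX1 : 1 ≤ X := by linarith
  have hX0 : 0 ≤ X := by linarith
  -- each binomial coefficient is at most `X^{m C(k,2)}`
  have hC : ∀ s ∈ Icc 1 k,
      (((m * t + m * s.choose 2 - 1).choose (m * s.choose 2) : ℕ) : ℝ) ≤ X ^ (m * k.choose 2) := by
    intro s hs
    simp only [Finset.mem_Icc] at hs
    have hdk : m * s.choose 2 ≤ m * k.choose 2 :=
      Nat.mul_le_mul_left m (Nat.choose_le_choose 2 hs.2)
    rcases Nat.eq_zero_or_pos (m * s.choose 2) with hd0 | hdpos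
    · rw [hd0, Nat.add_zero, Nat.choose_zero_right, Nat.cast_one]
      exact one_le_pow₀ hX1
    · calc (((m * t + m * s.choose 2 - 1).choose (m * s.choose 2) : ℕ) : ℝ)
            ≤ (Real.exp 1 * (1 + t)) ^ (m * s.choose 2) := by
            apply choose_le_exp_mul_pow hdpos
            have hmd : m ≤ m * s.choose 2 := by
              have h1 : 1 ≤ s.choose 2 := by
                by_contra h
                push Not at h
                have : s.choose 2 = 0 := by omega
                rw [this, mul_zero] at hdpos
                exact absurd hdpos (lt_irrefl 0)
              calc m = m * 1 := (mul_one m).symm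
                _ ≤ m * s.choose 2 := Nat.mul_le_mul_left m h1
            have h1 : m * t + m * s.choose 2 - 1 ≤ m * s.choose 2 * (1 + t) := by
              have : m * t ≤ m * s.choose 2 * t := Nat.mul_le_mul_right t hmd
              have : m * t + m * s.choose 2 - 1 ≤ m * t + m * s.choose 2 := Nat.sub_le _ _
              nlinarith
            exact_mod_cast h1
        _ ≤ X ^ (m * k.choose 2) := pow_le_pow_right₀ hX1 hdk
  -- each summand, as a real number
  have hterm : ∀ s ∈ Icc 1 k, ((m * (2 * (t - 1) + 1) +
      (2 * ((m * t + m * s.choose 2 - 1).choose (m * s.choose 2) - 1) + 1) : ℕ) : ℝ) ≤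
      m * (2 * t - 1) + (2 * X ^ (m * k.choose 2) - 1) := by
    intro s hs
    have hCpos : 1 ≤ (m * t + m * s.choose 2 - 1).choose (m * s.choose 2) := by
      apply Nat.choose_pos
      have : 1 ≤ m * t := Nat.one_le_iff_ne_zero.mpr (Nat.mul_ne_zero (by omega) (by omega))
      omega
    have := hC s hs
    push_cast [Nat.cast_sub ht, Nat.cast_sub hCpos]
    linarith
  -- summing over `s = 1, …, k`
  have hsum : ((∑ s ∈ Icc 1 k, (m * (2 * (t - 1) + 1) +
      (2 * ((m * t + m * s.choose 2 - 1).choose (m * s.choose 2) - 1) + 1)) : ℕ) : ℝ) ≤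
      k * (m * (2 * t - 1) + (2 * X ^ (m * k.choose 2) - 1)) := by
    push_cast
    calc _ ≤ ∑ _s ∈ Icc 1 k, ((m : ℝ) * (2 * t - 1) + (2 * X ^ (m * k.choose 2) - 1)) :=
          Finset.sum_le_sum fun s hs => by exact_mod_cast hterm s hs
      _ = k * (m * (2 * t - 1) + (2 * X ^ (m * k.choose 2) - 1)) := by
          rw [Finset.sum_const, Nat.card_Icc, nsmul_eq_mul]
          simp
  -- `k · X^{mC(k,2)} ≤ (√X)^{mk} · X^{mC(k,2)} = X^{mk²/2}`
  have hsq : Real.sqrt X ^ 2 = X := Real.sq_sqrt hX0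
  have h2 : (2 : ℝ) ≤ Real.sqrt X := by
    rw [Real.le_sqrt (by norm_num) hX0]
    linarith
  have hkpow : (k : ℝ) ≤ Real.sqrt X ^ (m * k) :=
    calc (k : ℝ) ≤ 2 ^ k := by exact_mod_cast (Nat.lt_two_pow_self).le
      _ ≤ Real.sqrt X ^ k := pow_le_pow_left₀ (by norm_num) h2 k
      _ ≤ Real.sqrt X ^ (m * k) := pow_le_pow_right₀ (by linarith) (Nat.le_mul_of_pos_left k hm)
  have hrpow : X ^ ((m * k ^ 2 : ℝ) / 2) = Real.sqrt X ^ (m * k) * X ^ (m * k.choose 2) := by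
    have hexp : m * k ^ 2 = m * k + 2 * (m * k.choose 2) := by
      rw [← add_two_mul_choose_two_eq_sq k]
      ring
    have hR : Real.sqrt X ^ (m * k) * X ^ (m * k.choose 2) = Real.sqrt X ^ (m * k ^ 2) := by
      rw [hexp, pow_add, pow_mul (Real.sqrt X) 2 (m * k.choose 2), hsq]
    have hL : X ^ ((m * k ^ 2 : ℝ) / 2) = Real.sqrt X ^ (m * k ^ 2) := by
      rw [Real.sqrt_eq_rpow, ← Real.rpow_natCast (X ^ (1 / (2 : ℝ))) (m * k ^ 2),
        ← Real.rpow_mul hX0]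
      congr 1
      push_cast
      ring
    exact hL.trans hR.symm
  have hP0 : 0 ≤ X ^ (m * k.choose 2) := pow_nonneg hX0 _
  have hkP : (k : ℝ) * X ^ (m * k.choose 2) ≤ X ^ ((m * k ^ 2 : ℝ) / 2) := by
    rw [hrpow]
    exact mul_le_mul_of_nonneg_right hkpow hP0
  -- conclusion
  rw [Nat.cast_add, Nat.cast_mul, Nat.cast_sub hk, Nat.cast_one, Nat.cast_ofNat]
  have hkm : (1 : ℝ) ≤ k * m := by nlinarith
  nlinarith [hsum, hkP, hP0, hkm]

/-- The elementary estimate closing the proof of Theorem 13 (p0007:L75–78):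
`k − 1 + 2 Σ_{s=1}^{k} (mδ + mδ·C(s,2)) = k − 1 + 2kmδ + 2mδ·C(k+1,3) ≤ k³mδ/3 + 2kmδ + k`.
[cite: KoiranPortierTavenas2015, proof of Thm. 13 (p0007:L75–78)] -/
theorem KPT2015_thm_13_estimate (k m δ : ℕ) :
    (((k - 1) + 2 * ∑ s ∈ Icc 1 k, (m * δ + m * δ * s.choose 2) : ℕ) : ℝ) ≤
      (k : ℝ) ^ 3 * m * δ / 3 + 2 * k * m * δ + k := by
  have hT : (k - 1) + 2 * ∑ s ∈ Icc 1 k, (m * δ + m * δ * s.choose 2) =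
      (k - 1) + 2 * (k * (m * δ)) + 2 * (m * δ) * (k + 1).choose 3 := by
    rw [Finset.sum_add_distrib, Finset.sum_const, Nat.card_Icc, ← Finset.mul_sum,
      sum_Icc_choose_two, smul_eq_mul]
    simp only [Nat.add_sub_cancel]
    ring
  rw [hT]
  have h6 : 6 * (((k + 1).choose 3 : ℕ) : ℝ) ≤ (k : ℝ) ^ 3 := by
    exact_mod_cast six_mul_choose_succ_three_le_cube k
  have hk1 : ((k - 1 : ℕ) : ℝ) ≤ k := by exact_mod_cast Nat.sub_le k 1
  have hmd : (0 : ℝ) ≤ m * δ := by positivity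
  push_cast
  nlinarith [mul_le_mul_of_nonneg_left h6 hmd]

/-! ### Dropping the identically zero `f_j` -/

/-- The print allows `f_j = 0` ("a polynomial with at most `t` monomials", p0006:L61–62); the
Wronskian argument wants `f_j ≠ 0`. Terms containing a positive power of a zero polynomial
vanish, and in the other terms the zero polynomials contribute `0^0 = 1`:
`Σ_i a_i Π_j f_j^{α_ij} = Σ_{i : α_ij = 0 whenever f_j = 0} a_i Π_{j : f_j ≠ 0} f_j^{α_ij}`.
[folklore] -/
private theorem sum_prod_pow_eq_subtype {ι κ : Type*} [Fintype ι] [Fintype κ] (f : κ → ℝ[X])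
    (a : ι → ℝ) (α : ι → κ → ℕ) :
    ∑ i, C (a i) * ∏ j, f j ^ α i j =
      ∑ i : {i : ι // ∀ j, f j = 0 → α i j = 0},
        C (a i) * ∏ j : {j : κ // f j ≠ 0}, f j ^ α i j := by
  classical
  rw [← Fintype.sum_subtype_add_sum_subtype (fun i : ι => ∀ j, f j = 0 → α i j = 0)
    (fun i => C (a i) * ∏ j, f j ^ α i j)]
  have hzero : ∑ i : {i : ι // ¬ ∀ j, f j = 0 → α i j = 0},
      C (a i) * ∏ j, f j ^ α (i : ι) j = 0 := by
    refine Finset.sum_eq_zero fun i _ => ?_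
    obtain ⟨j, hj, hα⟩ : ∃ j, f j = 0 ∧ α (i : ι) j ≠ 0 := by
      have := i.2
      push Not at this
      exact this
    rw [Finset.prod_eq_zero (Finset.mem_univ j) (by rw [hj, zero_pow hα]), mul_zero]
  rw [hzero, add_zero]
  refine Finset.sum_congr rfl fun i _ => ?_
  congr 1
  rw [← Fintype.prod_subtype_mul_prod_subtype (fun j : κ => f j ≠ 0)
    (fun j => f j ^ α (i : ι) j)]
  have hone : ∏ j : {j : κ // ¬ f j ≠ 0}, f j ^ α (i : ι) j = 1 := by
    refine Finset.prod_eq_one fun j _ => ?_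
    have hj : f j = 0 := by
      have := j.2
      push Not at this
      exact this
    rw [i.2 j hj, pow_zero]
  rw [hone, mul_one]

/-- **KPT 2015, Theorem 12** (p0006:L60–64): "Let `f = Σ_{i=1}^{k} a_i Π_{j=1}^{m} f_j^{α_{i,j}}`
be a non identically zero function such that `f_j` is a polynomial with at most `t` monomials
and such that `a_i ∈ ℝ` and `α_{i,j} ∈ ℕ`. Then `Z_ℝ(f) ≤ 4ktm + 4(e(1+t))^{mk²/2}`."
Typed for the real polynomial `P = Σ_{i:ι} C(a_i) Π_{j:κ} f_j^{α i j} ≠ 0` (`k = |ι|`, `m = |κ|`,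
`f_j ∈ ℝ[X]` with `|supp f_j| ≤ t`, zero `f_j` allowed), `Z_ℝ` = its number of distinct real
roots `P.roots.toFinset.card` (= the sibling files' `realZeros` of the function `x ↦ P(x)`, see
`KPT2015_thm_12_realZeros`), the bound as the printed real number with `e = Real.exp 1` and the
real exponent `mk²/2`. The sharper intermediate bound of the printed proof is
`KPT2015_thm_12_combinatorial`. NOT typed here: the "Moreover" clause (REAL, possibly negative,
powers `α_{i,j}` on an interval where every `f_j > 0`).
-- TODO(general form): real powers `α_{i,j}` on an interval `I` with `f_j(I) ⊆ ]0,+∞[`.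
[cite: KoiranPortierTavenas2015, Thm. 12] -/
theorem KPT2015_thm_12 {ι κ : Type*} [Fintype ι] [Fintype κ]
    (f : κ → ℝ[X]) (t : ℕ) (ht : ∀ j, (f j).support.card ≤ t)
    (a : ι → ℝ) (α : ι → κ → ℕ) (hP : ∑ i, C (a i) * ∏ j, f j ^ α i j ≠ 0) :
    ((∑ i, C (a i) * ∏ j, f j ^ α i j).roots.toFinset.card : ℝ) ≤
      4 * Fintype.card ι * t * Fintype.card κ +
        4 * (Real.exp 1 * (1 + t)) ^ ((Fintype.card κ * Fintype.card ι ^ 2 : ℝ) / 2) := by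
  classical
  have hX1 : (1 : ℝ) ≤ Real.exp 1 * (1 + t) := by
    have he : (1 : ℝ) ≤ Real.exp 1 := Real.one_le_exp (by norm_num)
    have : (1 : ℝ) ≤ 1 + t := by
      have : (0 : ℝ) ≤ t := Nat.cast_nonneg t
      linarith
    nlinarith
  -- drop the zero polynomials
  rw [sum_prod_pow_eq_subtype f a α] at hP ⊢
  have hk'k : Fintype.card {i : ι // ∀ j, f j = 0 → α i j = 0} ≤ Fintype.card ι :=
    Fintype.card_subtype_le _
  have hm'm : Fintype.card {j : κ // f j ≠ 0} ≤ Fintype.card κ := Fintype.card_subtype_le _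
  rcases Nat.eq_zero_or_pos (Fintype.card {j : κ // f j ≠ 0}) with hm0 | hm0
  · -- no non-zero `f_j`: the combination is a non-zero constant
    haveI : IsEmpty {j : κ // f j ≠ 0} := Fintype.card_eq_zero_iff.mp hm0
    have hconst : ∑ i : {i : ι // ∀ j, f j = 0 → α i j = 0},
        C (a i) * ∏ j : {j : κ // f j ≠ 0}, f j ^ α (i : ι) (j : κ) =
        C (∑ i : {i : ι // ∀ j, f j = 0 → α i j = 0}, a i) := by
      simp [map_sum]
    rw [hconst, Polynomial.roots_C, Multiset.toFinset_zero, Finset.card_empty, Nat.cast_zero]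
    positivity
  · have ht1 : 1 ≤ t := by
      obtain ⟨j⟩ := Fintype.card_pos_iff.mp hm0
      have h1 := ht j
      have hpos : 0 < (f (j : κ)).support.card :=
        Finset.card_pos.mpr (Polynomial.support_nonempty.mpr j.2)
      omega
    have hk1 : 1 ≤ Fintype.card {i : ι // ∀ j, f j = 0 → α i j = 0} := by
      rw [Nat.one_le_iff_ne_zero]
      intro h0
      haveI : IsEmpty {i : ι // ∀ j, f j = 0 → α i j = 0} := Fintype.card_eq_zero_iff.mp h0
      exact hP (by simp)
    have h1 := KPT2015_thm_12_combinatorial (fun j : {j : κ // f j ≠ 0} => f j) (fun j => j.2) t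
      (fun j => ht j) (fun i : {i : ι // ∀ j, f j = 0 → α i j = 0} => a i) (fun i j => α i j) hP
    have h2 := KPT2015_thm_12_estimate _ _ t hk1 hm0 ht1
    have hA : (4 * (Fintype.card {i : ι // ∀ j, f j = 0 → α i j = 0} : ℝ) * t *
        Fintype.card {j : κ // f j ≠ 0}) ≤ 4 * Fintype.card ι * t * Fintype.card κ := by
      gcongr
    have hB : (Real.exp 1 * (1 + t)) ^ ((Fintype.card {j : κ // f j ≠ 0} *
        Fintype.card {i : ι // ∀ j, f j = 0 → α i j = 0} ^ 2 : ℝ) / 2) ≤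
        (Real.exp 1 * (1 + t)) ^ ((Fintype.card κ * Fintype.card ι ^ 2 : ℝ) / 2) := by
      apply Real.rpow_le_rpow_of_exponent_le hX1
      gcongr
    exact ((Nat.cast_le.mpr h1).trans h2).trans (by linarith)

/-- **KPT 2015, Theorem 12** in the sibling files' vocabulary: `Z_ℝ(f) = realZeros f` of the
function `f(x) = Σ_i a_i Π_j f_j(x)^{α i j}` (evaluation of the polynomial of `KPT2015_thm_12`) is
a natural number `n ≤ 4ktm + 4(e(1+t))^{mk²/2}`. [cite: KoiranPortierTavenas2015, Thm. 12] -/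
theorem KPT2015_thm_12_realZeros {ι κ : Type*} [Fintype ι] [Fintype κ]
    (f : κ → ℝ[X]) (t : ℕ) (ht : ∀ j, (f j).support.card ≤ t)
    (a : ι → ℝ) (α : ι → κ → ℕ) (hP : ∑ i, C (a i) * ∏ j, f j ^ α i j ≠ 0) :
    ∃ n : ℕ, realZeros (fun x => (∑ i, C (a i) * ∏ j, f j ^ α i j).eval x) = n ∧
      (n : ℝ) ≤ 4 * Fintype.card ι * t * Fintype.card κ +
        4 * (Real.exp 1 * (1 + t)) ^ ((Fintype.card κ * Fintype.card ι ^ 2 : ℝ) / 2) :=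
  ⟨_, realZeros_eval_poly hP, KPT2015_thm_12 f t ht a α hP⟩

/-! ### Theorem 13 -/

/-- **KPT 2015, Theorem 13 — the intermediate bound of its proof** (p0007:L75–78: "the first
term is bounded by `md` and the second one by `md·C(s,2)`", summed by Theorem 9 with the factor
`2` on every `W_s` exactly as in the proof of Theorem 12, p0007:L37–47):
for `f = Σ_i a_i Π_j f_j^{α_ij} ≠ 0` with `k = |ι|` terms and `m = |κ|` NON-ZERO polynomials
`f_j` of degree `≤ d`, `Z_ℝ(f) ≤ k − 1 + 2 Σ_{s=1}^{k} (md + md·C(s,2))`.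
[cite: KoiranPortierTavenas2015, Thm. 13 (proof, p0007:L73–80)] -/
theorem KPT2015_thm_13_combinatorial {ι κ : Type*} [Fintype ι] [Fintype κ]
    (f : κ → ℝ[X]) (hf : ∀ j, f j ≠ 0) (d : ℕ) (hd : ∀ j, (f j).natDegree ≤ d)
    (a : ι → ℝ) (α : ι → κ → ℕ) (hP : ∑ i, C (a i) * ∏ j, f j ^ α i j ≠ 0) :
    (∑ i, C (a i) * ∏ j, f j ^ α i j).roots.toFinset.card ≤
      (Fintype.card ι - 1) + 2 * ∑ s ∈ Icc 1 (Fintype.card ι),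
        (Fintype.card κ * d + Fintype.card κ * d * s.choose 2) := by
  classical
  exact card_roots_sum_prod_pow_le_of_wronskian_bound f hf a α hP _
    fun s hs b β q hq hW => card_roots_wronskian_det_le_of_degree f hf d hd s _ hs b β q hq hW

/-- **KPT 2015, Theorem 13** (p0007:L67–72): "Let `f = Σ_{i=1}^{k} a_i Π_{j=1}^{m} f_j^{α_{i,j}}`
where `f` is not null, the `f_j` are of degrees bounded by `d` and such that `a_i` are reals and
`α_i` are integers. Then `Z_ℝ(f) ≤ (1/3)k³md + 2kmd + k`." Typed for the real polynomial
`P = Σ_{i:ι} C(a_i) Π_{j:κ} f_j^{α i j} ≠ 0` (`k = |ι|`, `m = |κ|`, `deg f_j ≤ d`, zero `f_j`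
allowed, `α_{i,j} ∈ ℕ`), `Z_ℝ` = `P.roots.toFinset.card` (and `KPT2015_thm_13_realZeros`).
NOT typed here: the "Moreover" clause (real powers on an interval where every `f_j > 0`).
-- TODO(general form): real powers `α_{i,j}` on an interval `I` with `f_j(I) ⊆ ℝ^{+*}`.
[cite: KoiranPortierTavenas2015, Thm. 13] -/
theorem KPT2015_thm_13 {ι κ : Type*} [Fintype ι] [Fintype κ]
    (f : κ → ℝ[X]) (d : ℕ) (hd : ∀ j, (f j).natDegree ≤ d)
    (a : ι → ℝ) (α : ι → κ → ℕ) (hP : ∑ i, C (a i) * ∏ j, f j ^ α i j ≠ 0) :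
    ((∑ i, C (a i) * ∏ j, f j ^ α i j).roots.toFinset.card : ℝ) ≤
      (Fintype.card ι : ℝ) ^ 3 * Fintype.card κ * d / 3 +
        2 * Fintype.card ι * Fintype.card κ * d + Fintype.card ι := by
  classical
  -- drop the zero polynomials
  rw [sum_prod_pow_eq_subtype f a α] at hP ⊢
  have hk'k : Fintype.card {i : ι // ∀ j, f j = 0 → α i j = 0} ≤ Fintype.card ι :=
    Fintype.card_subtype_le _
  have hm'm : Fintype.card {j : κ // f j ≠ 0} ≤ Fintype.card κ := Fintype.card_subtype_le _
  have h1 := KPT2015_thm_13_combinatorial (fun j : {j : κ // f j ≠ 0} => f j) (fun j => j.2) d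
    (fun j => hd j) (fun i : {i : ι // ∀ j, f j = 0 → α i j = 0} => a i) (fun i j => α i j) hP
  have h2 := KPT2015_thm_13_estimate (Fintype.card {i : ι // ∀ j, f j = 0 → α i j = 0})
    (Fintype.card {j : κ // f j ≠ 0}) d
  have hk' : (Fintype.card {i : ι // ∀ j, f j = 0 → α i j = 0} : ℝ) ≤ Fintype.card ι := by
    exact_mod_cast hk'k
  have hm' : (Fintype.card {j : κ // f j ≠ 0} : ℝ) ≤ Fintype.card κ := by exact_mod_cast hm'm
  have hA : (Fintype.card {i : ι // ∀ j, f j = 0 → α i j = 0} : ℝ) ^ 3 *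
      Fintype.card {j : κ // f j ≠ 0} * d / 3 +
      2 * Fintype.card {i : ι // ∀ j, f j = 0 → α i j = 0} * Fintype.card {j : κ // f j ≠ 0} * d +
      Fintype.card {i : ι // ∀ j, f j = 0 → α i j = 0} ≤
      (Fintype.card ι : ℝ) ^ 3 * Fintype.card κ * d / 3 +
        2 * Fintype.card ι * Fintype.card κ * d + Fintype.card ι := by
    gcongr
  exact ((Nat.cast_le.mpr h1).trans h2).trans hA

/-- **KPT 2015, Theorem 13** in the sibling files' vocabulary (`realZeros`).
[cite: KoiranPortierTavenas2015, Thm. 13] -/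
theorem KPT2015_thm_13_realZeros {ι κ : Type*} [Fintype ι] [Fintype κ]
    (f : κ → ℝ[X]) (d : ℕ) (hd : ∀ j, (f j).natDegree ≤ d)
    (a : ι → ℝ) (α : ι → κ → ℕ) (hP : ∑ i, C (a i) * ∏ j, f j ^ α i j ≠ 0) :
    ∃ n : ℕ, realZeros (fun x => (∑ i, C (a i) * ∏ j, f j ^ α i j).eval x) = n ∧
      (n : ℝ) ≤ (Fintype.card ι : ℝ) ^ 3 * Fintype.card κ * d / 3 +
        2 * Fintype.card ι * Fintype.card κ * d + Fintype.card ι :=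
  ⟨_, realZeros_eval_poly hP, KPT2015_thm_13 f d hd a α hP⟩

/-! ### §4.1 "Blackbox PIT algorithms": Corollaries 16 and 17 (the bounds as hitting sets) -/

/-- **KPT 2015, Corollary 16** (§4.1, p0008:L17–27): "Let `f = Σ_{i=1}^{k} a_i Π_{j=1}^{m}
f_j^{α_{i,j}}` be a function such that `f_j` is a polynomial with at most `t` monomials and such
that `a_i ∈ ℝ` and `α_{i,j} ∈ ℕ`. Then, there is a blackbox PIT algorithm which makes only
`1 + 4ktm + 4(e(1+t))^{mk²/2}` queries." Typed as the mathematical content of its printed proof: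
"We consider the algorithm which tests if the polynomial outputs zero on the
`1 + 4ktm + 4(e(1+t))^{mk²/2}` first integers. By Theorem 12, this set is a hitting set, that is,
if the polynomial is not zero, then at least one of these integers will not be a root of the
polynomial" — for every `N ≥ 1 + 4ktm + 4(e(1+t))^{mk²/2}`, a polynomial of the form vanishing at
`1, 2, …, N` is zero. The algorithmic wording (query complexity) is not typed.
[cite: KoiranPortierTavenas2015, Cor. 16] -/
theorem KPT2015_cor_16 {ι κ : Type*} [Fintype ι] [Fintype κ]
    (f : κ → ℝ[X]) (t : ℕ) (ht : ∀ j, (f j).support.card ≤ t) (a : ι → ℝ) (α : ι → κ → ℕ)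
    (N : ℕ) (hN : 1 + 4 * Fintype.card ι * t * Fintype.card κ +
      4 * (Real.exp 1 * (1 + t)) ^ ((Fintype.card κ * Fintype.card ι ^ 2 : ℝ) / 2) ≤ N)
    (hzero : ∀ n ∈ Icc 1 N, (∑ i, C (a i) * ∏ j, f j ^ α i j).eval (n : ℝ) = 0) :
    ∑ i, C (a i) * ∏ j, f j ^ α i j = 0 := by
  classical
  by_contra hP
  have h1 := KPT2015_thm_12 f t ht a α hP
  have h2 : N ≤ (∑ i, C (a i) * ∏ j, f j ^ α i j).roots.toFinset.card := by
    calc N = (Icc 1 N).card := by simp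
      _ = ((Icc 1 N).image (fun n : ℕ => (n : ℝ))).card :=
          (Finset.card_image_of_injective _ Nat.cast_injective).symm
      _ ≤ _ := Finset.card_le_card fun x hx => by
          obtain ⟨n, hn, rfl⟩ := Finset.mem_image.mp hx
          rw [Multiset.mem_toFinset, mem_roots hP, IsRoot.def]
          exact hzero n hn
  have h3 := (Nat.cast_le (α := ℝ).mpr h2).trans h1
  linarith

/-- **KPT 2015, Corollary 17** (§4.1, p0008:L29–33): "Let `f = Σ_{i=1}^{k} a_i Π_{j=1}^{m}
f_j^{α_{i,j}}` where the `f_j` are of degree bounded by `d` and such that `a_i` are reals and `α_i`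
are integers. Then, there is a blackbox PIT algorithm which makes only `1 + (1/3)k³md + 2kmd + k`
queries." ("We apply Theorem 13.") Typed as for Corollary 16: for every
`N ≥ 1 + k³md/3 + 2kmd + k`, a polynomial of the form (natural exponents) vanishing at
`1, 2, …, N` is zero. [cite: KoiranPortierTavenas2015, Cor. 17] -/
theorem KPT2015_cor_17 {ι κ : Type*} [Fintype ι] [Fintype κ]
    (f : κ → ℝ[X]) (d : ℕ) (hd : ∀ j, (f j).natDegree ≤ d) (a : ι → ℝ) (α : ι → κ → ℕ)
    (N : ℕ) (hN : 1 + ((Fintype.card ι : ℝ) ^ 3 * Fintype.card κ * d / 3 +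
      2 * Fintype.card ι * Fintype.card κ * d + Fintype.card ι) ≤ N)
    (hzero : ∀ n ∈ Icc 1 N, (∑ i, C (a i) * ∏ j, f j ^ α i j).eval (n : ℝ) = 0) :
    ∑ i, C (a i) * ∏ j, f j ^ α i j = 0 := by
  classical
  by_contra hP
  have h1 := KPT2015_thm_13 f d hd a α hP
  have h2 : N ≤ (∑ i, C (a i) * ∏ j, f j ^ α i j).roots.toFinset.card := by
    calc N = (Icc 1 N).card := by simp
      _ = ((Icc 1 N).image (fun n : ℕ => (n : ℝ))).card :=
          (Finset.card_image_of_injective _ Nat.cast_injective).symm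
      _ ≤ _ := Finset.card_le_card fun x hx => by
          obtain ⟨n, hn, rfl⟩ := Finset.mem_image.mp hx
          rw [Multiset.mem_toFinset, mem_roots hP, IsRoot.def]
          exact hzero n hn
  have h3 := (Nat.cast_le (α := ℝ).mpr h2).trans h1
  linarith

end Literature.Computability.AlgebraicComplexity.KoiranPortierTavenas2015
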